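import Literature.MathematicalPhysics.QuantumFieldTheory.Balaban1983to89.B9Thm37GlueTorusInv

/-!
# `Balaban1983to89.B9Thm37GlueTorusRW` — the binders `h342_1` … `h342_4` of the one-scale ℓ¹ torus model
# (Corollary-3.6-type entries of (3.42) for the Dirichlet local inverses G′_□ = Ω₀(□)(…)^{−1}Ω₀(□))
# DISCHARGED in the massive regime q ≥ q_min > 0 by a random-walk comparison (maximum principle);
# sibling leaf of `B9Thm37GlueTorusInv` (own lineage pv21; imports `B9Thm37GlueTorusInv` only; modifies nothing)

References (bib keys; the tags below cite only these):
* [B9] = `Balaban1985BackgroundPropagators` — T. Bałaban, *Propagators for lattice gauge theories in a background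
  field*, Commun. Math. Phys. 99 (1985) 389–434.
* [4] = `Balaban1984PropagatorsII` — T. Bałaban, *Propagators and renormalization transformations for lattice gauge
  theories. II*, Commun. Math. Phys. 96 (1984) 223–250.

THE PRINTED LOCI.  Only loci certified in the headers of modules in this file's import closure are cited: [B9]
(3.3) pp. 390–391 (the covariant derivative in components, `B9Thm37Glue` v3), (3.23) p. 394 and (3.8) p. 392 (Δ_U =
D\*D in components, `B9Thm37Glue` v5), p. 394 (G′ = the inverse of the Dirichlet operator Ω₀Δ′_aΩ₀) and p. 395
(positivity), both `B9Thm37GlueTorusInv`, (3.42) p. 397 (the printed shape of the four entries, `B6RandomWalkHom` /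
`B9Thm37Glue`), Corollary 3.6 p. 409 (*"satisfy all the inequalities of Theorems 3.1–3.3 correspondingly"*,
`B9Thm37Glue` / `B9Thm37GlueSz` §5), Theorem 3.7 (3.87)–(3.90) pp. 408–410 (`B9Thm37Glue`); [4] (2.46) p. 231 and
(2.51) p. 232 (block majorants, `B6RandomWalk`), Lemma 2.1 and Proposition 2.2 (2.64)–(2.66) p. 234 (the random-walk
summations and the printed remark that the local bound on G′₀ comes from (2.37)/(2.43)/(2.44), `B6RandomWalk`
header).  No locus outside the import closure is used, and no statement of this file quotes print: every
declaration below is either a MODEL definition or a kernel-checked theorem about the one-scale model of the lineage.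

THE POINT (value = kernel-checked certificate + non-vacuity of the `h342_*` family, NOT summit progress).  After
`B9Thm37GlueTorusInv` the four entries of (3.42) for G′ = (Δ_U + M_q)^{−1} stand in the one-scale ℓ¹ torus model
(`torusGeom N η L M`, identity chart `chart0`, b05 partition of unity, nearest-neighbour bonds b = (x, μ) with b₋ = x,
b₊ = x + e_μ and constant weight c₀, orthogonal component matrices R(U(b)) = `Rm b`, strictly positive site weight
q) modulo: compatibility, `hRm`, ranges, `hsmall`, `hχ01`, `hχ`, and the SUBSTANTIVE inputs `h342_1` … `h342_4` —
Corollary-3.6-type off-diagonal decay of the Dirichlet local inverses G′_□ := `dirInv (Δ_U + M_q) Ω₀(□)` and of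
∇_U G′_□, G′_□∇\*_U, Δ_U G′_□ (print: Theorems 3.1–3.3 for the sequence {Ω_n(□)}, p. 409).  THIS FILE proves the
four `h342_*` in the model's massive regime q ≥ q_min > 0 (§7: `h342_1_rw`, `h342_2_rw`, `h342_3_rw`, `h342_4_rw`,
conclusions literally the binders of `B9Thm37GlueTorusInv.thm37_entryn_l1_pos`), with decay rate any δ₀ ≥ 0 such
that r := 2dc₀²/(2dc₀² + q_min) ≤ e^{−δ₀} (`rwRate`; a strictly positive one always exists, `exists_rate`) and the
explicit constants
  entry 1: √|Cp|/q_min ≤ B₀η²;   entry 2: |c₀|√|Cp|(1 + e^{δ₀})/q_min ≤ B₀η;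
  entry 3: d|c₀|√|Cp|(1 + e^{δ₀})/q_min ≤ B₀η;   entry 4: 2dc₀²√|Cp|(1 + e^{δ₀})/q_min ≤ B₀
(|Cp| = the number of components; √|Cp| is the price of reading a sup-norm source in the fibrewise Euclidean norm).
§8 then gives the capstones `thm37_entryn_l1_rw` (n = 1, 2, 3, 4) = `…_l1_pos` with `h342_*` DISCHARGED: the four
entries of (3.42) for G′ = `Ring.inverse (Δ_U + M_q)` on the one-scale torus with NO operator-theoretic hypothesis
left — from compatibility (1 ≤ M₀ ∣ N_i, 2M₀ ≤ N_i), `hRm`, the numeric ranges, `hsmall`, q ≥ q_min > 0, r ≤ e^{−δ₀},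
the constant inequalities above, and `hχ01`, `hχ` (Ω₀(□) {0,1}-valued and = 1 on the (M₀ + 1)-ball round the centre
of □; `B9Thm37GlueTorusInv.chiBall` is one).

THE METHOD (folklore; NOT print's random-walk expansion, which treats the massless multiscale operator — here the
mass q_min > 0 does the work).  §1–§2: the component vector of a function over one point read in the Euclidean space
ℝ^{Cp} (`fibVec`); orthonormal columns ⇒ orthonormal rows, so R(U(b)) and R(U(b))ᵀ act isometrically on fibres
(`norm_mulVec_eq`, `norm_vecMul_eq`) — this is where `hRm` enters and why the fibre ℓ² norm is used (a sup-norm per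
component loses √|Cp| at every step of the walk; the ℓ² norm loses it once, at the source).  §3: for orthogonal
R(U(b)), (Δ_U f)(x, i) = 2dc₀²f(x, i) − c₀²(hop f)(x, i) (`covLap_apply`), the hop collecting R(U(b))ᵀf(b₋, ·) over
the d bonds ending at x and R(U(b))f(b₊, ·) over the d bonds starting at x, whence ‖(hop f)(x, ·)‖₂ ≤ Σ ‖f(nbr, ·)‖₂
(`norm_fibVec_hopT_le`).  §4: the ℓ¹ torus distance in lattice units `l1N` (`tdist1` = its cast) changes by at most
one along a bond.  §5: the discrete maximum principle on the finite torus (`maxPrinciple`, `comparison`) for the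
sub-stochastic averaging u ↦ θ₀c₀²·nb(u), θ₀ = (2dc₀² + q_min)^{−1}, total weight 2dθ₀c₀² = r < 1; the geometric
profile ρ_s(x) = r^{l1N(x, s)}/q_min is a supersolution for a unit source at s (`superSol`: one step costs a factor
r, and θ₀ + r/q_min = 1/q_min at the source).  §6: if F solves the Dirichlet sandwich equation (Ω₀(Δ_U + M_q)Ω₀ +
(1 − Ω₀))F = Ω₀μ then u(x) = ‖F(x, ·)‖₂ is a subsolution, u ≤ θ₀(c₀²nb(u) + ‖μ(x, ·)‖₂) (`subSol`: on Ω₀ from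
`covLap_apply`, q ≥ q_min and the isometries; off Ω₀, F = 0); comparison gives the fibrewise resolvent bound
‖(G′_□μ)(x, ·)‖₂ ≤ Σ_s ‖μ(s, ·)‖₂ r^{l1N(x, s)}/q_min (`dirInv_fib_le`; `dirInv A Ω₀ μ = Ω₀·(sandwich)^{−1}(Ω₀μ)`
is definitional, the sandwich is a unit by `B9Thm37GlueTorusInv.posDef_sandwich`), and for a source located over
one point y′, ≤ √|Cp|·B·r^{l1N(x, y′)}/q_min (`dirInv_fib_le_of_supp`).  §7: rⁿ ≤ e^{−δ₀n} gives entry 1; entries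
2, 3, 4 apply D = ∇_U, D\* = ∇\*_U (nearest-neighbour, weight |c₀|, isometric R(U(b))) before or after G′_□, each
lattice step of slack costing one factor e^{δ₀} (`pow_le_exp_neg_shift`); entry 4 uses Δ_UG′_□ = 2dc₀²G′_□ −
c₀²hop∘G′_□ fibrewise.  No series, no smallness condition beyond q_min > 0.

NON-VACUITY / SCALING (why the constants are honest).  In lattice units c₀ = η^{−1} (the η-derivative of (3.3)) and a
mass of the order of the cutoff, q_min = a₀η^{−2} (a₀ > 0), the rate is r = 2d/(2d + a₀) (`rwRate_scale`, η-free), so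
δ₀ = log((2d + a₀)/2d) > 0 is η-free, and the four constant inequalities read B₀ ≥ √|Cp|/a₀, B₀ ≥ √|Cp|(1 + e^{δ₀})/a₀,
B₀ ≥ d√|Cp|(1 + e^{δ₀})/a₀, B₀ ≥ 2d√|Cp|(1 + e^{δ₀})/a₀ — all η-free; with these, `hsmall` of the capstones is
7^d B₀ e^{δ₀ρ}((d + d|Cp|)(4d/M₀)(2⌊ρ⌋₊ + 1)^d + 52d/M₀²)c₁(d, δ₀, α) < 1 (entry 3: (1 + |Cp|) in place of
(d + d|Cp|)), i.e. "M₀ large", uniformly in η.  So the hypotheses of `thm37_entryn_l1_rw` are simultaneously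
satisfiable for every lattice spacing η > 0 on every compatible torus: the `h342_*` family of the lineage is not
vacuous, and the located smallness `hsmall` is compatible with it.

REMAINING HYPOTHESES of the §8 capstones (NOT asserted): compatibility (1 ≤ M₀ ∣ N_i, 2M₀ ≤ N_i); `hRm` (Σ_k
Rm(b)_{ki}Rm(b)_{kj} = δ_{ij} — a theorem for unitary U(b) in trace-orthonormal hermitian components elsewhere in the
package, not imported here); the ranges (0 ≤ B₀, 0 < δ₀, 0 < α ≤ 1 resp. ≤ ½, 1 ≤ ρ, 0 ≤ η resp. 0 < η); `hsmall`;
q ≥ q_min > 0 (`hqmin`, `hq`); r ≤ e^{−δ₀} (`hre`); the constant inequalities `hB1` … `hB4`; `hχ01`, `hχ`.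

NOT ASSERTED.  Print's Corollary 3.6 and Theorems 3.1–3.3 themselves (the multiscale operators G′(Ω), Q′_j, the
sequences {Ω_n(□)}, the massless regime with a(L^jη)^{−2}Q′\*Q′ in place of a strictly positive site weight, the
regularity of U of p. 395) — the model's M_q with q ≥ q_min > 0 is NOT print's Q′\*aQ′; scales j ≥ 1; optimal
constants or rates (print's δ₀ is not this file's); that the method of this file is print's; anything about the
summit.  The file certifies exactly: in the one-scale massive model, the Corollary-3.6-shaped inputs of the lineage's
Theorem-3.7 bookkeeping are THEOREMS, with explicit η-uniform constants.
-/

namespace Literature.MathematicalPhysics.QuantumFieldTheory.Balaban1983to89.B9Thm37GlueTorusRW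

open Finset B6RandomWalk B6RandomWalkHom B9Thm37Sum B9Thm34Ext B9Thm37Glue B9Thm37GlueT B9Thm37GlueSt B9Thm37GlueSz
open B9Thm37GluePU B9Thm37GlueChart B9Thm37GlueTorus B9Thm37GlueTorusE123 B9Thm37GlueTorusInv
open B5TorusCover (UT Ctr ctrU)
open B5Leibniz121 (up dist_up_le)
open B4Sect5Torus (ccoord ccoord_self ccoord_triangle ccoord_symm)

noncomputable section

/-! ## §1  Fibre vectors: the Euclidean norm on the components over one point -/

section Fibre

variable {X Cp : Type}

/-- MODEL bookkeeping: the component vector of `f` over the point `x`, read in the Euclidean space ℝ^{Cp}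
(the fibrewise ℓ² norm in which the walk of this file is run). [folklore] -/
def fibVec (f : X × Cp → ℝ) (x : X) : EuclideanSpace ℝ Cp := WithLp.toLp 2 (fun i => f (x, i))

/-- Components of `fibVec`. [folklore] -/
@[simp] theorem fibVec_apply (f : X × Cp → ℝ) (x : X) (i : Cp) : fibVec f x i = f (x, i) := rfl

/-- The fibre vector of `χ·f` for a scalar `χ` depending on the point only. [folklore] -/
theorem fibVec_mulOp_comp_fst (χ : X → ℝ) (f : X × Cp → ℝ) (x : X) :
    fibVec (mulOp (χ ∘ Prod.fst) f) x = χ x • fibVec f x := by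
  ext i
  simp [fibVec, mulOp_apply]

variable [Fintype Cp]

/-- The Euclidean norm of a real vector as the square root of the sum of squares. [folklore] -/
theorem norm_toLp_eq_sqrt (a : Cp → ℝ) : ‖(WithLp.toLp 2 a : EuclideanSpace ℝ Cp)‖ = Real.sqrt (∑ i, a i ^ 2) := by
  rw [EuclideanSpace.norm_eq]
  congr 1
  exact Finset.sum_congr rfl fun i _ => by rw [PiLp.toLp_apply, Real.norm_eq_abs, sq_abs]

/-- A component is bounded by the Euclidean norm. [folklore] -/
theorem abs_le_norm_fibVec (f : X × Cp → ℝ) (x : X) (i : Cp) : |f (x, i)| ≤ ‖fibVec f x‖ := by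
  have h := PiLp.norm_apply_le (fibVec f x) i
  rwa [fibVec_apply, Real.norm_eq_abs] at h

/-- Pointwise domination of components by a multiple gives domination of the norms. [folklore] -/
theorem norm_toLp_le_of_abs_le {a b : Cp → ℝ} {t : ℝ} (ht : 0 ≤ t) (h : ∀ i, |a i| ≤ t * |b i|) :
    ‖(WithLp.toLp 2 a : EuclideanSpace ℝ Cp)‖ ≤ t * ‖(WithLp.toLp 2 b : EuclideanSpace ℝ Cp)‖ := by
  rw [norm_toLp_eq_sqrt, norm_toLp_eq_sqrt]
  have hsum : ∑ i, a i ^ 2 ≤ t ^ 2 * ∑ i, b i ^ 2 := by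
    rw [Finset.mul_sum]
    refine Finset.sum_le_sum fun i _ => ?_
    have h1 : |a i| ^ 2 ≤ (t * |b i|) ^ 2 := pow_le_pow_left₀ (abs_nonneg _) (h i) 2
    rw [sq_abs, mul_pow, sq_abs] at h1
    exact h1
  calc Real.sqrt (∑ i, a i ^ 2) ≤ Real.sqrt (t ^ 2 * ∑ i, b i ^ 2) := Real.sqrt_le_sqrt hsum
    _ = t * Real.sqrt (∑ i, b i ^ 2) := by rw [Real.sqrt_mul (sq_nonneg t), Real.sqrt_sq ht]

/-- The sup–ℓ² comparison: components bounded by `B` give norm at most `√|Cp|·B`. [folklore] -/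
theorem norm_fibVec_le_sqrt_card (f : X × Cp → ℝ) (x : X) {B : ℝ} (hB : 0 ≤ B) (h : ∀ i, |f (x, i)| ≤ B) :
    ‖fibVec f x‖ ≤ Real.sqrt (Fintype.card Cp) * B := by
  rw [fibVec, norm_toLp_eq_sqrt]
  have hsum : ∑ i, f (x, i) ^ 2 ≤ (Fintype.card Cp : ℝ) * B ^ 2 := by
    have h1 : ∀ i ∈ (Finset.univ : Finset Cp), f (x, i) ^ 2 ≤ B ^ 2 := fun i _ => by
      have := pow_le_pow_left₀ (abs_nonneg _) (h i) 2
      rwa [sq_abs] at this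
    have h2 := Finset.sum_le_card_nsmul _ _ _ h1
    rwa [Finset.card_univ, nsmul_eq_mul] at h2
  calc Real.sqrt (∑ i, f (x, i) ^ 2) ≤ Real.sqrt ((Fintype.card Cp : ℝ) * B ^ 2) := Real.sqrt_le_sqrt hsum
    _ = Real.sqrt (Fintype.card Cp) * B := by rw [Real.sqrt_mul (Nat.cast_nonneg _), Real.sqrt_sq hB]

/-- `‖(χf)(x, ·)‖₂ = |χ(x)|·‖f(x, ·)‖₂` for a scalar χ depending on the point only. [folklore] -/
theorem norm_fibVec_mulOp_comp_fst (χ : X → ℝ) (f : X × Cp → ℝ) (x : X) :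
    ‖fibVec (mulOp (χ ∘ Prod.fst) f) x‖ = |χ x| * ‖fibVec f x‖ := by
  rw [fibVec_mulOp_comp_fst, norm_smul, Real.norm_eq_abs]

end Fibre

/-! ## §2  Orthogonal component matrices act isometrically on the fibres -/

section Orth

variable {Cp : Type} [Fintype Cp] [DecidableEq Cp]

/-- Columns orthonormal ⇒ rows orthonormal (a square matrix with `RᵀR = 1` has `RRᵀ = 1`). [folklore] -/
theorem rows_orth {R : Cp → Cp → ℝ} (hR : ∀ i j, ∑ k, R k i * R k j = if i = j then 1 else 0) (i j : Cp) :
    ∑ k, R i k * R j k = if i = j then 1 else 0 := by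
  have h1 : (Matrix.of fun i j => R i j).transpose * (Matrix.of fun i j => R i j) = 1 := by
    ext i' j'
    rw [Matrix.mul_apply, Matrix.one_apply]
    simpa only [Matrix.transpose_apply, Matrix.of_apply] using hR i' j'
  have h2 : (Matrix.of fun i j => R i j) * (Matrix.of fun i j => R i j).transpose = 1 := mul_eq_one_comm.mp h1
  have h3 := congrFun (congrFun h2 i) j
  rw [Matrix.mul_apply, Matrix.one_apply] at h3
  simpa only [Matrix.transpose_apply, Matrix.of_apply] using h3

/-- `‖R v‖ = ‖v‖` for `R` with orthonormal columns. [folklore] -/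
theorem norm_mulVec_eq {R : Cp → Cp → ℝ} (hR : ∀ i j, ∑ k, R k i * R k j = if i = j then 1 else 0)
    (v : Cp → ℝ) :
    ‖(WithLp.toLp 2 (fun k => ∑ j, R k j * v j) : EuclideanSpace ℝ Cp)‖ =
      ‖(WithLp.toLp 2 v : EuclideanSpace ℝ Cp)‖ := by
  rw [← sq_eq_sq₀ (norm_nonneg _) (norm_nonneg _), EuclideanSpace.real_norm_sq_eq,
    EuclideanSpace.real_norm_sq_eq]
  show ∑ k, (∑ j, R k j * v j) ^ 2 = ∑ j, v j ^ 2
  calc ∑ k, (∑ j, R k j * v j) ^ 2 = ∑ k, ∑ j, ∑ j', R k j * v j * (R k j' * v j') := by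
        refine Finset.sum_congr rfl fun k _ => ?_
        rw [sq, Finset.sum_mul_sum]
    _ = ∑ j, ∑ j', (∑ k, R k j * R k j') * (v j * v j') := by
        rw [Finset.sum_comm]
        refine Finset.sum_congr rfl fun j _ => ?_
        rw [Finset.sum_comm]
        refine Finset.sum_congr rfl fun j' _ => ?_
        rw [Finset.sum_mul]
        exact Finset.sum_congr rfl fun k _ => by ring
    _ = ∑ j, v j ^ 2 := by
        refine Finset.sum_congr rfl fun j _ => ?_
        simp_rw [hR j]
        simp [Finset.sum_ite_eq, sq]

/-- `‖Rᵀ w‖ = ‖w‖` for `R` with orthonormal columns. [folklore] -/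
theorem norm_vecMul_eq {R : Cp → Cp → ℝ} (hR : ∀ i j, ∑ k, R k i * R k j = if i = j then 1 else 0)
    (w : Cp → ℝ) :
    ‖(WithLp.toLp 2 (fun i => ∑ k, R k i * w k) : EuclideanSpace ℝ Cp)‖ =
      ‖(WithLp.toLp 2 w : EuclideanSpace ℝ Cp)‖ := by
  have hR' := rows_orth hR
  exact norm_mulVec_eq (R := fun i k => R k i) hR' w

end Orth

/-! ## §3  The covariant Laplacian Δ_U = D*D in components: diagonal 2dc₀² and the nearest-neighbour hop -/

section CovLap

variable {d : ℕ} {N : Fin d → ℕ} [∀ i, NeZero (N i)] {Cp : Type} [Fintype Cp] [DecidableEq Cp]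

/-- MODEL bookkeeping: the two-slot nearest-neighbour sum over the bonds at a point — the bonds ENDING at `x`
weighted by `φ`, the bonds STARTING at `x` weighted by `ψ`. [folklore] -/
def nb2 (φ ψ : UT N × Fin d → ℝ) (x : UT N) : ℝ :=
  ∑ b : UT N × Fin d, ((if btgt b = x then φ b else 0) + (if bsrc b = x then ψ b else 0))

/-- `Σ_b 1_{b₊ = x} = d`. [folklore] -/
theorem sum_ind_tgt (x : UT N) : ∑ b : UT N × Fin d, (if btgt b = x then (1 : ℝ) else 0) = d := by
  rw [Finset.sum_boole, card_tgt_star]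

omit [∀ i, NeZero (N i)] in
/-- `Σ_b 1_{b₋ = x} = d`. [folklore] -/
theorem sum_ind_src (x : UT N) : ∑ b : UT N × Fin d, (if bsrc b = x then (1 : ℝ) else 0) = d := by
  rw [Finset.sum_boole, card_src_star]

/-- Bounding a two-slot neighbour sum slot by slot: `d` bonds end at `x`, `d` bonds start at `x`. [folklore] -/
theorem nb2_le {φ ψ : UT N × Fin d → ℝ} {x : UT N} {t₁ t₂ : ℝ} (h₁ : ∀ b, btgt b = x → φ b ≤ t₁)
    (h₂ : ∀ b, bsrc b = x → ψ b ≤ t₂) : nb2 φ ψ x ≤ d * t₁ + d * t₂ := by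
  unfold nb2
  rw [Finset.sum_add_distrib]
  refine add_le_add ?_ ?_
  · calc ∑ b : UT N × Fin d, (if btgt b = x then φ b else 0)
        ≤ ∑ b : UT N × Fin d, (if btgt b = x then t₁ else 0) :=
          Finset.sum_le_sum fun b _ => by
            by_cases hb : btgt b = x
            · rw [if_pos hb, if_pos hb]; exact h₁ b hb
            · rw [if_neg hb, if_neg hb]
      _ = d * t₁ := by
          rw [← sum_ind_tgt (N := N) x, Finset.sum_mul]
          exact Finset.sum_congr rfl fun b _ => by split_ifs <;> simp
  · calc ∑ b : UT N × Fin d, (if bsrc b = x then ψ b else 0)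
        ≤ ∑ b : UT N × Fin d, (if bsrc b = x then t₂ else 0) :=
          Finset.sum_le_sum fun b _ => by
            by_cases hb : bsrc b = x
            · rw [if_pos hb, if_pos hb]; exact h₂ b hb
            · rw [if_neg hb, if_neg hb]
      _ = d * t₂ := by
          rw [← sum_ind_src (N := N) x, Finset.sum_mul]
          exact Finset.sum_congr rfl fun b _ => by split_ifs <;> simp

/-- Two-slot neighbour sums are nonnegative for nonnegative weights. [folklore] -/
theorem nb2_nonneg {φ ψ : UT N × Fin d → ℝ} (h₁ : ∀ b, 0 ≤ φ b) (h₂ : ∀ b, 0 ≤ ψ b) (x : UT N) :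
    0 ≤ nb2 φ ψ x :=
  Finset.sum_nonneg fun b _ => add_nonneg (by split_ifs; exacts [h₁ b, le_rfl]) (by split_ifs; exacts [h₂ b, le_rfl])

/-- Monotonicity of two-slot neighbour sums. [folklore] -/
theorem nb2_mono {φ ψ φ' ψ' : UT N × Fin d → ℝ} (h₁ : ∀ b, φ b ≤ φ' b) (h₂ : ∀ b, ψ b ≤ ψ' b) (x : UT N) :
    nb2 φ ψ x ≤ nb2 φ' ψ' x :=
  Finset.sum_le_sum fun b _ => add_le_add (by split_ifs; exacts [h₁ b, le_rfl]) (by split_ifs; exacts [h₂ b, le_rfl])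

/-- Two-slot neighbour sums are additive. [folklore] -/
theorem nb2_sub (φ ψ φ' ψ' : UT N × Fin d → ℝ) (x : UT N) :
    nb2 φ ψ x - nb2 φ' ψ' x = nb2 (fun b => φ b - φ' b) (fun b => ψ b - ψ' b) x := by
  unfold nb2
  rw [← Finset.sum_sub_distrib]
  exact Finset.sum_congr rfl fun b _ => by split_ifs <;> ring

/-- Linear combinations pass through two-slot neighbour sums. [folklore] -/
theorem nb2_sum_mul {ι : Type} (s : Finset ι) (m : ι → ℝ) (φ ψ : ι → UT N × Fin d → ℝ) (x : UT N) :
    ∑ a ∈ s, m a * nb2 (φ a) (ψ a) x = nb2 (fun b => ∑ a ∈ s, m a * φ a b) (fun b => ∑ a ∈ s, m a * ψ a b) x := by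
  unfold nb2
  simp only [Finset.mul_sum]
  rw [Finset.sum_comm]
  refine Finset.sum_congr rfl fun b _ => ?_
  by_cases h1 : btgt b = x <;> by_cases h2 : bsrc b = x <;> simp [h1, h2, Finset.sum_add_distrib, mul_add]

/-- Summing a two-slot neighbour sum against a site weight relocates the weight to the bond ends:
`Σ_s nb2 φ ψ s · ρ(s) = Σ_b (φ(b)ρ(b₊) + ψ(b)ρ(b₋))`. [folklore] -/
theorem sum_nb2_mul (φ ψ : UT N × Fin d → ℝ) (ρ : UT N → ℝ) :
    ∑ s : UT N, nb2 φ ψ s * ρ s = ∑ b : UT N × Fin d, (φ b * ρ (btgt b) + ψ b * ρ (bsrc b)) := by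
  unfold nb2
  simp only [Finset.sum_mul, Finset.sum_add_distrib, add_mul, ite_mul, zero_mul]
  rw [Finset.sum_comm, Finset.sum_comm (f := fun x b => if bsrc b = x then ψ b * ρ x else 0)]
  simp only [Finset.sum_ite_eq, Finset.mem_univ, if_true]

/-- MODEL bookkeeping: the nearest-neighbour hop of Δ_U = D\*D at a site component — the bonds ending at the point
act by R(U(b))ᵀ on the fibre over their source, the bonds starting at it by R(U(b)) on the fibre over their target
(cf. `covLap_apply`). [cite: Balaban1985BackgroundPropagators, (3.3) pp.390–391 + (3.23) p.394 + (3.8) p.392] -/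
def hopT (Rm : UT N × Fin d → Cp → Cp → ℝ) (f : UT N × Cp → ℝ) (p : UT N × Cp) : ℝ :=
  ∑ b : UT N × Fin d, ((if btgt b = p.1 then ∑ k, Rm b k p.2 * f (bsrc b, k) else 0) +
    (if bsrc b = p.1 then ∑ j, Rm b p.2 j * f (btgt b, j) else 0))

/-- MODEL bookkeeping: R(U(b))ᵀ acting on a fibre vector. [cite: Balaban1985BackgroundPropagators, (3.8) p.392] -/
def actT (Rm : UT N × Fin d → Cp → Cp → ℝ) (b : UT N × Fin d) (w : EuclideanSpace ℝ Cp) : EuclideanSpace ℝ Cp :=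
  WithLp.toLp 2 (fun i => ∑ k, Rm b k i * w k)

/-- MODEL bookkeeping: R(U(b)) acting on a fibre vector. [cite: Balaban1985BackgroundPropagators, (3.3) pp.390–391] -/
def act (Rm : UT N × Fin d → Cp → Cp → ℝ) (b : UT N × Fin d) (v : EuclideanSpace ℝ Cp) : EuclideanSpace ℝ Cp :=
  WithLp.toLp 2 (fun i => ∑ j, Rm b i j * v j)

omit [∀ i, NeZero (N i)] in
/-- R(U(b))ᵀ is an isometry on fibres for orthogonal R(U(b)). [folklore] -/
theorem norm_actT (Rm : UT N × Fin d → Cp → Cp → ℝ)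
    (hRm : ∀ b i j, ∑ k, Rm b k i * Rm b k j = if i = j then 1 else 0) (b : UT N × Fin d)
    {Y : Type} (g : Y × Cp → ℝ) (y : Y) : ‖actT Rm b (fibVec g y)‖ = ‖fibVec g y‖ :=
  norm_vecMul_eq (hRm b) (fun k => g (y, k))

omit [∀ i, NeZero (N i)] in
/-- R(U(b)) is an isometry on fibres for orthogonal R(U(b)). [folklore] -/
theorem norm_act (Rm : UT N × Fin d → Cp → Cp → ℝ)
    (hRm : ∀ b i j, ∑ k, Rm b k i * Rm b k j = if i = j then 1 else 0) (b : UT N × Fin d)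
    {Y : Type} (g : Y × Cp → ℝ) (y : Y) : ‖act Rm b (fibVec g y)‖ = ‖fibVec g y‖ :=
  norm_mulVec_eq (hRm b) (fun k => g (y, k))

omit [DecidableEq Cp] in
/-- The hop at a point as a sum of rotated neighbour fibre vectors. [folklore] -/
theorem fibVec_hopT (Rm : UT N × Fin d → Cp → Cp → ℝ) (f : UT N × Cp → ℝ) (x : UT N) :
    fibVec (hopT Rm f) x = ∑ b : UT N × Fin d, ((if btgt b = x then actT Rm b (fibVec f (bsrc b)) else 0) +
      (if bsrc b = x then act Rm b (fibVec f (btgt b)) else 0)) := by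
  ext i
  simp only [fibVec_apply, hopT, WithLp.ofLp_sum, WithLp.ofLp_add, Finset.sum_apply, Pi.add_apply]
  refine Finset.sum_congr rfl fun b _ => ?_
  congr 1
  · split_ifs <;> rfl
  · split_ifs <;> rfl

/-- **Fibre bound of the hop**: `‖(hop f)(x)‖ ≤ Σ_{b₊ = x} ‖f(b₋)‖ + Σ_{b₋ = x} ‖f(b₊)‖` for orthogonal R(U(b)). [folklore] -/
theorem norm_fibVec_hopT_le (Rm : UT N × Fin d → Cp → Cp → ℝ)
    (hRm : ∀ b i j, ∑ k, Rm b k i * Rm b k j = if i = j then 1 else 0) (f : UT N × Cp → ℝ) (x : UT N) :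
    ‖fibVec (hopT Rm f) x‖ ≤ nb2 (fun b => ‖fibVec f (bsrc b)‖) (fun b => ‖fibVec f (btgt b)‖) x := by
  rw [fibVec_hopT]
  refine (norm_sum_le _ _).trans (Finset.sum_le_sum fun b _ => (norm_add_le _ _).trans (add_le_add ?_ ?_))
  · split_ifs
    · exact (norm_actT Rm hRm b f (bsrc b)).le
    · rw [norm_zero]
  · split_ifs
    · exact (norm_act Rm hRm b f (btgt b)).le
    · rw [norm_zero]

/-- `Σ_k R(b)_{ki}(Df)(b, k) = c₀(f(b₊, i) − Σ_k R(b)_{ki} f(b₋, k))` for orthogonal R(U(b)). [cite: Balaban1985BackgroundPropagators, (3.3) pp.390–391] -/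
theorem sum_Rm_covD (c₀ : ℝ) (Rm : UT N × Fin d → Cp → Cp → ℝ)
    (hRm : ∀ b i j, ∑ k, Rm b k i * Rm b k j = if i = j then 1 else 0) (f : UT N × Cp → ℝ)
    (b : UT N × Fin d) (i : Cp) :
    ∑ k, Rm b k i * covD bsrc btgt (fun _ : UT N × Fin d => c₀) Rm f (b, k) =
      c₀ * (f (btgt b, i) - ∑ k, Rm b k i * f (bsrc b, k)) := by
  simp only [covD_apply]
  have h1 : ∀ k, Rm b k i * (c₀ * (∑ j, Rm b k j * f (btgt b, j) - f (bsrc b, k))) =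
      c₀ * (∑ j, Rm b k i * Rm b k j * f (btgt b, j)) - c₀ * (Rm b k i * f (bsrc b, k)) := fun k => by
    have e : Rm b k i * ∑ j, Rm b k j * f (btgt b, j) = ∑ j, Rm b k i * Rm b k j * f (btgt b, j) := by
      rw [Finset.mul_sum]
      exact Finset.sum_congr rfl fun j _ => by ring
    rw [← e]
    ring
  rw [Finset.sum_congr rfl fun k _ => h1 k, Finset.sum_sub_distrib, ← Finset.mul_sum, ← Finset.mul_sum,
    Finset.sum_comm]
  have e2 : ∀ j, ∑ k, Rm b k i * Rm b k j * f (btgt b, j) = (if i = j then 1 else 0) * f (btgt b, j) :=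
    fun j => by rw [← Finset.sum_mul, hRm b i j]
  rw [Finset.sum_congr rfl fun j _ => e2 j]
  simp only [ite_mul, one_mul, zero_mul, Finset.sum_ite_eq, Finset.mem_univ, if_true]
  ring

/-- The bond-by-bond term of D\*Df at a site component. [cite: Balaban1985BackgroundPropagators, (3.3) pp.390–391 + (3.8) p.392] -/
theorem covLap_term (c₀ : ℝ) (Rm : UT N × Fin d → Cp → Cp → ℝ)
    (hRm : ∀ b i j, ∑ k, Rm b k i * Rm b k j = if i = j then 1 else 0) (f : UT N × Cp → ℝ)
    (p : UT N × Cp) (b : UT N × Fin d) :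
    (if btgt b = p.1 then c₀ else 0) * ∑ k, Rm b k p.2 * covD bsrc btgt (fun _ : UT N × Fin d => c₀) Rm f (b, k) -
        (if bsrc b = p.1 then c₀ else 0) * covD bsrc btgt (fun _ : UT N × Fin d => c₀) Rm f (b, p.2) =
      c₀ ^ 2 * ((if btgt b = p.1 then 1 else 0) + (if bsrc b = p.1 then 1 else 0)) * f p -
        c₀ ^ 2 * ((if btgt b = p.1 then ∑ k, Rm b k p.2 * f (bsrc b, k) else 0) +
          (if bsrc b = p.1 then ∑ j, Rm b p.2 j * f (btgt b, j) else 0)) := by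
  rw [sum_Rm_covD c₀ Rm hRm f b p.2, covD_apply]
  obtain ⟨x, i⟩ := p
  by_cases h1 : btgt b = x <;> by_cases h2 : bsrc b = x <;>
    simp only [h1, h2, if_true, if_false] <;> ring

/-- **Δ_U = D*D at a site component, for orthogonal R(U(b))**: (Δ_U f)(x, i) = 2dc₀² f(x, i) − c₀²(hop f)(x, i)
— the diagonal 2d·c₀² (d bonds in, d bonds out, RᵀR = 1) and the nearest-neighbour hop.
[cite: Balaban1985BackgroundPropagators, (3.23) p.394 + (3.3) pp.390–391 + (3.8) p.392] -/
theorem covLap_apply (c₀ : ℝ) (Rm : UT N × Fin d → Cp → Cp → ℝ)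
    (hRm : ∀ b i j, ∑ k, Rm b k i * Rm b k j = if i = j then 1 else 0) (f : UT N × Cp → ℝ)
    (p : UT N × Cp) :
    (covDT bsrc btgt (fun _ : UT N × Fin d => c₀) Rm ∘ₗ covD bsrc btgt (fun _ : UT N × Fin d => c₀) Rm) f p =
      c₀ ^ 2 * (2 * d) * f p - c₀ ^ 2 * hopT Rm f p := by
  rw [LinearMap.comp_apply, covDT_apply]
  rw [Finset.sum_congr rfl fun b _ => covLap_term c₀ Rm hRm f p b, Finset.sum_sub_distrib, ← Finset.sum_mul,
    ← Finset.mul_sum, Finset.sum_add_distrib, sum_ind_tgt, sum_ind_src, ← Finset.mul_sum]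
  unfold hopT
  ring

end CovLap

/-! ## §4  The ℓ¹ torus distance as a natural number; one lattice step changes it by at most one -/

section L1N

variable {d : ℕ} {N : Fin d → ℕ} [∀ i, NeZero (N i)]

/-- MODEL bookkeeping: the ℓ¹ torus distance in lattice units as a natural number (`tdist1` is its cast) — the
one-scale stand-in for the multiscale distance d(y, y′) of (2.46). [cite: Balaban1984PropagatorsII, (2.46) p.231] -/
def l1N (N : Fin d → ℕ) [∀ i, NeZero (N i)] (x y : UT N) : ℕ := ∑ i, ccoord N (UT.toSite N x) (UT.toSite N y) i

/-- `tdist1 = ↑l1N`. [folklore] -/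
theorem tdist1_eq_cast (x y : UT N) : tdist1 N x y = (l1N N x y : ℝ) := by
  unfold tdist1 l1N
  push_cast
  rfl

/-- `l1N x x = 0`. [folklore] -/
theorem l1N_self (x : UT N) : l1N N x x = 0 := by
  have h := tdist1_self (N := N) x
  rw [tdist1_eq_cast] at h
  exact_mod_cast h

/-- `l1N` is symmetric. [folklore] -/
theorem l1N_comm (x y : UT N) : l1N N x y = l1N N y x := by
  have h := tdist1_comm (N := N) x y
  rw [tdist1_eq_cast, tdist1_eq_cast] at h
  exact_mod_cast h

/-- One step along a bond from its source: `l1N(b₋, y) ≤ l1N(b₊, y) + 1`. [folklore] -/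
theorem l1N_le_up_add (x y : UT N) (μ : Fin d) : l1N N x y ≤ l1N N (up x μ) y + 1 := by
  have h1 := tdist1_triangle (N := N) x (up x μ) y
  have h2 := tdist1_up_le (N := N) x μ
  rw [tdist1_eq_cast, tdist1_eq_cast, tdist1_eq_cast] at h1
  rw [tdist1_eq_cast] at h2
  have h3 : (l1N N x y : ℝ) ≤ (l1N N (up x μ) y : ℝ) + 1 := by linarith
  exact_mod_cast h3

/-- One step along a bond from its target: `l1N(b₊, y) ≤ l1N(b₋, y) + 1`. [folklore] -/
theorem l1N_up_le_add (x y : UT N) (μ : Fin d) : l1N N (up x μ) y ≤ l1N N x y + 1 := by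
  have h1 := tdist1_triangle (N := N) (up x μ) x y
  have h2 := tdist1_up_le (N := N) x μ
  rw [tdist1_comm] at h2
  rw [tdist1_eq_cast, tdist1_eq_cast, tdist1_eq_cast] at h1
  rw [tdist1_eq_cast] at h2
  have h3 : (l1N N (up x μ) y : ℝ) ≤ (l1N N x y : ℝ) + 1 := by linarith
  exact_mod_cast h3

/-- Geometric decay along one bond (source end): `r^{l1N(b₊, y)} ≤ r^{l1N(b₋, y) ∸ 1}` for `0 ≤ r ≤ 1`. [folklore] -/
theorem pow_l1N_up_le {r : ℝ} (hr0 : 0 ≤ r) (hr1 : r ≤ 1) (x y : UT N) (μ : Fin d) :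
    r ^ l1N N (up x μ) y ≤ r ^ (l1N N x y - 1) :=
  pow_le_pow_of_le_one hr0 hr1 (by have := l1N_le_up_add (N := N) x y μ; omega)

/-- Geometric decay along one bond (target end): `r^{l1N(b₋, y)} ≤ r^{l1N(b₊, y) ∸ 1}` for `0 ≤ r ≤ 1`. [folklore] -/
theorem pow_l1N_le_up {r : ℝ} (hr0 : 0 ≤ r) (hr1 : r ≤ 1) (x y : UT N) (μ : Fin d) :
    r ^ l1N N x y ≤ r ^ (l1N N (up x μ) y - 1) :=
  pow_le_pow_of_le_one hr0 hr1 (by have := l1N_up_le_add (N := N) x y μ; omega)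

/-- `rⁿ ≤ e^{−δ₀ n}` for `0 ≤ r ≤ e^{−δ₀}`. [folklore] -/
theorem pow_le_exp_neg {r δ₀ : ℝ} (hr0 : 0 ≤ r) (hr : r ≤ Real.exp (-δ₀)) (n : ℕ) :
    r ^ n ≤ Real.exp (-(δ₀ * n)) := by
  calc r ^ n ≤ Real.exp (-δ₀) ^ n := pow_le_pow_left₀ hr0 hr n
    _ = Real.exp (-(δ₀ * n)) := by rw [← Real.exp_nat_mul]; ring_nf

/-- `r^{n′} ≤ e^{δ₀}e^{−δ₀ n}` for `0 ≤ r ≤ e^{−δ₀}`, `0 ≤ δ₀` and `n ≤ n′ + 1` (one step of slack). [folklore] -/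
theorem pow_le_exp_neg_shift {r δ₀ : ℝ} (hr0 : 0 ≤ r) (hr : r ≤ Real.exp (-δ₀)) (hδ : 0 ≤ δ₀) {n n' : ℕ}
    (h : n ≤ n' + 1) : r ^ n' ≤ Real.exp δ₀ * Real.exp (-(δ₀ * n)) := by
  have h1 : (n : ℝ) ≤ n' + 1 := by exact_mod_cast h
  calc r ^ n' ≤ Real.exp (-(δ₀ * n')) := pow_le_exp_neg hr0 hr n'
    _ ≤ Real.exp (δ₀ + -(δ₀ * n)) := Real.exp_le_exp.mpr (by nlinarith)
    _ = Real.exp δ₀ * Real.exp (-(δ₀ * n)) := Real.exp_add _ _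

end L1N

/-! ## §5  The scalar comparison argument: maximum principle for the sub-stochastic neighbour averaging, and the
geometric supersolution -/

section MaxPrinciple

variable {d : ℕ} {N : Fin d → ℕ} [∀ i, NeZero (N i)]

/-- **Maximum principle.**  If `v ≤ a·(Σ_{b₊ = x} v(b₋) + Σ_{b₋ = x} v(b₊))` pointwise with `a ≥ 0` and
`a·2d < 1` (sub-stochastic averaging), then `v ≤ 0`: at a maximum point x*, v(x*) ≤ 2da·v(x*) < v(x*) unless
v(x*) ≤ 0. [folklore] -/
theorem maxPrinciple {a : ℝ} (ha : 0 ≤ a) (ha1 : a * (2 * d) < 1) (v : UT N → ℝ)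
    (hv : ∀ x, v x ≤ a * nb2 (fun b => v (bsrc b)) (fun b => v (btgt b)) x) : ∀ x, v x ≤ 0 := by
  intro x₀
  obtain ⟨xm, -, hxm⟩ := Finset.exists_max_image Finset.univ v ⟨x₀, Finset.mem_univ _⟩
  have hle : ∀ y, v y ≤ v xm := fun y => hxm y (Finset.mem_univ _)
  refine (hle x₀).trans ?_
  by_contra hpos
  replace hpos : 0 < v xm := not_le.mp hpos
  have h1 : nb2 (fun b => v (bsrc b)) (fun b => v (btgt b)) xm ≤ d * v xm + d * v xm :=
    nb2_le (fun b _ => hle _) (fun b _ => hle _)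
  have h2 : v xm ≤ a * (2 * d) * v xm := by
    calc v xm ≤ a * nb2 (fun b => v (bsrc b)) (fun b => v (btgt b)) xm := hv xm
      _ ≤ a * (d * v xm + d * v xm) := mul_le_mul_of_nonneg_left h1 ha
      _ = a * (2 * d) * v xm := by ring
  have h3 : a * (2 * d) * v xm < 1 * v xm := mul_lt_mul_of_pos_right ha1 hpos
  linarith

/-- **Comparison.**  A subsolution `u ≤ g + a·nb(u)` lies below any supersolution `w ≥ g + a·nb(w)`. [folklore] -/
theorem comparison {a : ℝ} (ha : 0 ≤ a) (ha1 : a * (2 * d) < 1) (u w g : UT N → ℝ)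
    (hu : ∀ x, u x ≤ g x + a * nb2 (fun b => u (bsrc b)) (fun b => u (btgt b)) x)
    (hw : ∀ x, g x + a * nb2 (fun b => w (bsrc b)) (fun b => w (btgt b)) x ≤ w x) : ∀ x, u x ≤ w x := by
  have h := maxPrinciple (N := N) ha ha1 (fun x => u x - w x) fun x => by
    have e := nb2_sub (N := N) (fun b => u (bsrc b)) (fun b => u (btgt b)) (fun b => w (bsrc b))
      (fun b => w (btgt b)) x
    have := hu x
    have := hw x
    rw [← e, mul_sub]
    linarith
  intro x
  have := h x
  linarith

/-- MODEL constant of the one-scale walk: the ratio r = 2dc₀²θ₀ = 2dc₀²/(2dc₀² + q_min) (total hop weight per step),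
θ₀ = (2dc₀² + q_min)^{−1} being the bound of the inverse diagonal.  NOT print's δ₀ or its rate. [folklore] -/
def rwRate (d : ℕ) (c₀ qmin : ℝ) : ℝ := 2 * d * c₀ ^ 2 / (2 * d * c₀ ^ 2 + qmin)

/-- `0 ≤ r` (q_min > 0). [folklore] -/
theorem rwRate_nonneg (d : ℕ) (c₀ : ℝ) {qmin : ℝ} (hq : 0 < qmin) : 0 ≤ rwRate d c₀ qmin :=
  div_nonneg (by positivity) (by positivity)

/-- `r < 1` (q_min > 0). [folklore] -/
theorem rwRate_lt_one (d : ℕ) (c₀ : ℝ) {qmin : ℝ} (hq : 0 < qmin) : rwRate d c₀ qmin < 1 := by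
  unfold rwRate
  rw [div_lt_one (by positivity)]
  linarith

/-- `r ≤ 1` (q_min > 0). [folklore] -/
theorem rwRate_le_one (d : ℕ) (c₀ : ℝ) {qmin : ℝ} (hq : 0 < qmin) : rwRate d c₀ qmin ≤ 1 :=
  (rwRate_lt_one d c₀ hq).le

/-- `θ₀·c₀²·2d = r`. [folklore] -/
theorem theta_mul (d : ℕ) (c₀ qmin : ℝ) :
    (2 * d * c₀ ^ 2 + qmin)⁻¹ * c₀ ^ 2 * (2 * d) = rwRate d c₀ qmin := by
  unfold rwRate
  rw [div_eq_mul_inv]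
  ring

/-- `θ₀ + r/q_min = 1/q_min` (i.e. θ₀q_min + r = 1). [folklore] -/
theorem theta_add (d : ℕ) (c₀ : ℝ) {qmin : ℝ} (hq : 0 < qmin) :
    (2 * d * c₀ ^ 2 + qmin)⁻¹ + rwRate d c₀ qmin / qmin = 1 / qmin := by
  unfold rwRate
  have h1 : (2 * d * c₀ ^ 2 + qmin) ≠ 0 := by positivity
  field_simp
  ring

/-- A decay rate for the walk: any δ₀ with r ≤ e^{−δ₀}; for instance δ₀ = −log r (r > 0) or any δ₀ (r = 0).
There is always a strictly positive one. [folklore] -/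
theorem exists_rate (d : ℕ) (c₀ : ℝ) {qmin : ℝ} (hq : 0 < qmin) :
    ∃ δ₀ : ℝ, 0 < δ₀ ∧ rwRate d c₀ qmin ≤ Real.exp (-δ₀) := by
  by_cases h0 : rwRate d c₀ qmin = 0
  · exact ⟨1, one_pos, by rw [h0]; exact (Real.exp_pos _).le⟩
  · have hpos : 0 < rwRate d c₀ qmin := lt_of_le_of_ne (rwRate_nonneg d c₀ hq) (Ne.symm h0)
    refine ⟨-Real.log (rwRate d c₀ qmin), ?_, ?_⟩
    · exact neg_pos.mpr (Real.log_neg hpos (rwRate_lt_one d c₀ hq))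
    · rw [neg_neg, Real.exp_log hpos]

/-- **The geometric supersolution** for a unit source at `s`: with ρ_s(x) = r^{l1N(x, s)}/q_min,
θ₀·1_{x = s} + θ₀c₀²·nb(ρ_s)(x) ≤ ρ_s(x) — one lattice step costs a factor r, the 2d neighbours carry total
weight 2dθ₀c₀² = r, and at the source θ₀ + r/q_min = 1/q_min. [folklore] -/
theorem superSol (c₀ : ℝ) {qmin : ℝ} (hq : 0 < qmin) (s x : UT N) :
    (2 * d * c₀ ^ 2 + qmin)⁻¹ * (if x = s then 1 else 0) +
        (2 * d * c₀ ^ 2 + qmin)⁻¹ * c₀ ^ 2 *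
          nb2 (fun b => rwRate d c₀ qmin ^ l1N N (bsrc b) s / qmin)
            (fun b => rwRate d c₀ qmin ^ l1N N (btgt b) s / qmin) x ≤
      rwRate d c₀ qmin ^ l1N N x s / qmin := by
  set r := rwRate d c₀ qmin with hr
  have hr0 : 0 ≤ r := rwRate_nonneg d c₀ hq
  have hr1 : r ≤ 1 := rwRate_le_one d c₀ hq
  have hθ : 0 ≤ (2 * d * c₀ ^ 2 + qmin)⁻¹ := by positivity
  -- the neighbours of x are one step from x: their decay factor is at most r^{l1N(x,s) ∸ 1}
  have hnb : nb2 (fun b => r ^ l1N N (bsrc b) s / qmin) (fun b => r ^ l1N N (btgt b) s / qmin) x ≤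
      d * (r ^ (l1N N x s - 1) / qmin) + d * (r ^ (l1N N x s - 1) / qmin) := by
    refine nb2_le (fun b hb => ?_) (fun b hb => ?_)
    · obtain ⟨z, μ⟩ := b
      simp only [btgt_apply] at hb
      simp only [bsrc_apply]
      rw [← hb]
      exact div_le_div_of_nonneg_right (pow_l1N_le_up hr0 hr1 z s μ) hq.le
    · obtain ⟨z, μ⟩ := b
      simp only [bsrc_apply] at hb
      simp only [btgt_apply]
      rw [hb]
      have := pow_l1N_up_le (N := N) hr0 hr1 x s μ
      rw [← hb] at this ⊢
      exact div_le_div_of_nonneg_right this hq.le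
  have key : (2 * d * c₀ ^ 2 + qmin)⁻¹ * c₀ ^ 2 *
      nb2 (fun b => r ^ l1N N (bsrc b) s / qmin) (fun b => r ^ l1N N (btgt b) s / qmin) x ≤
      r * (r ^ (l1N N x s - 1) / qmin) := by
    calc (2 * d * c₀ ^ 2 + qmin)⁻¹ * c₀ ^ 2 *
          nb2 (fun b => r ^ l1N N (bsrc b) s / qmin) (fun b => r ^ l1N N (btgt b) s / qmin) x
        ≤ (2 * d * c₀ ^ 2 + qmin)⁻¹ * c₀ ^ 2 * (d * (r ^ (l1N N x s - 1) / qmin) + d * (r ^ (l1N N x s - 1) / qmin)) :=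
          mul_le_mul_of_nonneg_left hnb (by positivity)
      _ = (2 * d * c₀ ^ 2 + qmin)⁻¹ * c₀ ^ 2 * (2 * d) * (r ^ (l1N N x s - 1) / qmin) := by ring
      _ = r * (r ^ (l1N N x s - 1) / qmin) := by rw [theta_mul d c₀ qmin]
  rcases Nat.eq_zero_or_pos (l1N N x s) with h0 | hpos
  · -- at distance 0: θ₀·1 + r/q_min = 1/q_min
    rw [h0] at key ⊢
    simp only [Nat.zero_sub, pow_zero] at key ⊢
    have hind : (2 * d * c₀ ^ 2 + qmin)⁻¹ * (if x = s then (1 : ℝ) else 0) ≤ (2 * d * c₀ ^ 2 + qmin)⁻¹ :=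
      by split_ifs <;> simp [hθ]
    have := theta_add d c₀ hq
    rw [← hr] at this
    have e : r * (1 / qmin) = r / qmin := by ring
    linarith
  · -- at distance n + 1 ≥ 1: x ≠ s and r·r^n = r^{n+1}
    have hne : x ≠ s := by
      rintro rfl
      rw [l1N_self] at hpos
      exact lt_irrefl 0 hpos
    rw [if_neg hne, mul_zero, zero_add]
    have e : r * (r ^ (l1N N x s - 1) / qmin) = r ^ l1N N x s / qmin := by
      rw [mul_div_assoc', ← pow_succ']
      congr 2
      omega
    linarith [key, e.le, e.ge]

end MaxPrinciple

/-! ## §6  The fibre norms of a solution of the Dirichlet sandwich equation form a subsolution -/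

section Resolvent

variable {d : ℕ} {N : Fin d → ℕ} [∀ i, NeZero (N i)] {Cp : Type} [Fintype Cp] [DecidableEq Cp]

/-- The Dirichlet sandwich Ω₀(Δ_U + M_q)Ω₀ + (1 − Ω₀) at a site component, for orthogonal R(U(b)). [cite: Balaban1985BackgroundPropagators, p.394 + (3.23) p.394] -/
theorem sandwich_apply (c₀ : ℝ) (Rm : UT N × Fin d → Cp → Cp → ℝ)
    (hRm : ∀ b i j, ∑ k, Rm b k i * Rm b k j = if i = j then 1 else 0) (q : UT N × Cp → ℝ) (χ : UT N → ℝ)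
    (F : UT N × Cp → ℝ) (p : UT N × Cp) :
    (mulOp (χ ∘ Prod.fst) * (covDT bsrc btgt (fun _ : UT N × Fin d => c₀) Rm ∘ₗ
        covD bsrc btgt (fun _ : UT N × Fin d => c₀) Rm + mulOp q) * mulOp (χ ∘ Prod.fst) +
        mulOp (1 - χ ∘ Prod.fst) : Module.End ℝ (UT N × Cp → ℝ)) F p =
      χ p.1 * ((c₀ ^ 2 * (2 * d) + q p) * (χ p.1 * F p) - c₀ ^ 2 * hopT Rm (mulOp (χ ∘ Prod.fst) F) p) +
        (1 - χ p.1) * F p := by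
  simp only [LinearMap.add_apply, Pi.add_apply, Module.End.mul_apply, mulOp_apply, covLap_apply c₀ Rm hRm,
    Function.comp_apply, Pi.sub_apply, Pi.one_apply]
  ring

/-- **Subsolution.**  If F solves the Dirichlet sandwich equation (Ω₀(Δ_U + M_q)Ω₀ + (1 − Ω₀))F = Ω₀μ with q ≥ q_min > 0,
then u(x) = ‖F(x, ·)‖₂ satisfies u(x) ≤ θ₀‖μ(x, ·)‖₂ + θ₀c₀²(Σ_{b₊ = x} u(b₋) + Σ_{b₋ = x} u(b₊)): on Ω₀ the
diagonal (2dc₀² + q(x, i)) ≥ θ₀^{−1} is inverted and the hop is bounded fibrewise by the isometries R(U(b)); off Ω₀,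
F = 0. [folklore] -/
theorem subSol (c₀ : ℝ) (Rm : UT N × Fin d → Cp → Cp → ℝ)
    (hRm : ∀ b i j, ∑ k, Rm b k i * Rm b k j = if i = j then 1 else 0) (q : UT N × Cp → ℝ) {qmin : ℝ}
    (hqmin : 0 < qmin) (hq : ∀ p, qmin ≤ q p) {χ : UT N → ℝ} (hχ01 : ∀ x, χ x = 0 ∨ χ x = 1)
    {F μ : UT N × Cp → ℝ}
    (hF : (mulOp (χ ∘ Prod.fst) * (covDT bsrc btgt (fun _ : UT N × Fin d => c₀) Rm ∘ₗ
        covD bsrc btgt (fun _ : UT N × Fin d => c₀) Rm + mulOp q) * mulOp (χ ∘ Prod.fst) +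
        mulOp (1 - χ ∘ Prod.fst) : Module.End ℝ (UT N × Cp → ℝ)) F = mulOp (χ ∘ Prod.fst) μ) (x : UT N) :
    ‖fibVec F x‖ ≤ (2 * d * c₀ ^ 2 + qmin)⁻¹ * ‖fibVec μ x‖ +
      (2 * d * c₀ ^ 2 + qmin)⁻¹ * c₀ ^ 2 * nb2 (fun b => ‖fibVec F (bsrc b)‖) (fun b => ‖fibVec F (btgt b)‖) x := by
  have hθ : 0 < (2 * d * c₀ ^ 2 + qmin)⁻¹ := by positivity
  have hnb0 : 0 ≤ nb2 (fun b => ‖fibVec F (bsrc b)‖) (fun b => ‖fibVec F (btgt b)‖) x :=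
    nb2_nonneg (fun _ => norm_nonneg _) (fun _ => norm_nonneg _) x
  have hG : ∀ z, ‖fibVec (mulOp (χ ∘ Prod.fst) F) z‖ ≤ ‖fibVec F z‖ := fun z => by
    rw [norm_fibVec_mulOp_comp_fst]
    rcases hχ01 z with h | h
    · rw [h, abs_zero, zero_mul]; exact norm_nonneg _
    · rw [h, abs_one, one_mul]
  have hpt : ∀ i, χ x * ((c₀ ^ 2 * (2 * d) + q (x, i)) * (χ x * F (x, i)) -
      c₀ ^ 2 * hopT Rm (mulOp (χ ∘ Prod.fst) F) (x, i)) + (1 - χ x) * F (x, i) = χ x * μ (x, i) := fun i => by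
    have h := congrFun hF (x, i)
    rw [sandwich_apply c₀ Rm hRm q χ F (x, i)] at h
    simpa only [mulOp_apply, Function.comp_apply] using h
  rcases hχ01 x with h0 | h1
  · -- off Ω₀: F(x, ·) = 0
    have hz : ∀ i, F (x, i) = 0 := fun i => by have := hpt i; rw [h0] at this; linarith
    have : fibVec F x = 0 := by ext i; simp [fibVec, hz]
    rw [this, norm_zero]
    positivity
  · -- on Ω₀: (2dc₀² + q(x,i)) F(x,i) = μ(x,i) + c₀²(hop Ω₀F)(x,i)
    have heq : ∀ i, (c₀ ^ 2 * (2 * d) + q (x, i)) * F (x, i) =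
        μ (x, i) + c₀ ^ 2 * hopT Rm (mulOp (χ ∘ Prod.fst) F) (x, i) := fun i => by
      have := hpt i; rw [h1] at this; linarith
    have habs : ∀ i, |F (x, i)| ≤ (2 * d * c₀ ^ 2 + qmin)⁻¹ *
        |μ (x, i) + c₀ ^ 2 * hopT Rm (mulOp (χ ∘ Prod.fst) F) (x, i)| := fun i => by
      have hl : 2 * d * c₀ ^ 2 + qmin ≤ c₀ ^ 2 * (2 * d) + q (x, i) := by have := hq (x, i); linarith
      have hlpos : 0 < c₀ ^ 2 * (2 * d) + q (x, i) := lt_of_lt_of_le (by positivity) hl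
      have e : F (x, i) = (μ (x, i) + c₀ ^ 2 * hopT Rm (mulOp (χ ∘ Prod.fst) F) (x, i)) /
          (c₀ ^ 2 * (2 * d) + q (x, i)) := by
        rw [eq_div_iff hlpos.ne', mul_comm]; exact heq i
      rw [e, abs_div, abs_of_pos hlpos, div_eq_mul_inv, mul_comm]
      exact mul_le_mul_of_nonneg_right (inv_anti₀ (by positivity) hl) (abs_nonneg _)
    have h2 := norm_toLp_le_of_abs_le hθ.le habs
    have hvec : (WithLp.toLp 2 (fun i => μ (x, i) + c₀ ^ 2 * hopT Rm (mulOp (χ ∘ Prod.fst) F) (x, i)) :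
        EuclideanSpace ℝ Cp) = fibVec μ x + c₀ ^ 2 • fibVec (hopT Rm (mulOp (χ ∘ Prod.fst) F)) x := by
      ext i
      simp [fibVec]
    have h3 : ‖fibVec μ x + c₀ ^ 2 • fibVec (hopT Rm (mulOp (χ ∘ Prod.fst) F)) x‖ ≤
        ‖fibVec μ x‖ + c₀ ^ 2 * nb2 (fun b => ‖fibVec F (bsrc b)‖) (fun b => ‖fibVec F (btgt b)‖) x := by
      refine (norm_add_le _ _).trans (add_le_add le_rfl ?_)
      rw [norm_smul, Real.norm_eq_abs, abs_of_nonneg (sq_nonneg c₀)]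
      refine mul_le_mul_of_nonneg_left ?_ (sq_nonneg c₀)
      exact (norm_fibVec_hopT_le Rm hRm _ x).trans (nb2_mono (fun b => hG _) (fun b => hG _) x)
    rw [hvec] at h2
    calc ‖fibVec F x‖ ≤ (2 * d * c₀ ^ 2 + qmin)⁻¹ *
          ‖fibVec μ x + c₀ ^ 2 • fibVec (hopT Rm (mulOp (χ ∘ Prod.fst) F)) x‖ := h2
      _ ≤ (2 * d * c₀ ^ 2 + qmin)⁻¹ *
          (‖fibVec μ x‖ + c₀ ^ 2 * nb2 (fun b => ‖fibVec F (bsrc b)‖) (fun b => ‖fibVec F (btgt b)‖) x) :=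
          mul_le_mul_of_nonneg_left h3 hθ.le
      _ = _ := by ring

/-- The supersolution for a general nonnegative source weight m: superposition of `superSol`. [folklore] -/
theorem superSol_sum (c₀ : ℝ) {qmin : ℝ} (hq : 0 < qmin) (m : UT N → ℝ) (hm : ∀ s, 0 ≤ m s) (x : UT N) :
    (2 * d * c₀ ^ 2 + qmin)⁻¹ * m x + (2 * d * c₀ ^ 2 + qmin)⁻¹ * c₀ ^ 2 *
        nb2 (fun b => ∑ s, m s * (rwRate d c₀ qmin ^ l1N N (bsrc b) s / qmin))
          (fun b => ∑ s, m s * (rwRate d c₀ qmin ^ l1N N (btgt b) s / qmin)) x ≤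
      ∑ s, m s * (rwRate d c₀ qmin ^ l1N N x s / qmin) := by
  have e := nb2_sum_mul (N := N) Finset.univ m (fun s b => rwRate d c₀ qmin ^ l1N N (bsrc b) s / qmin)
    (fun s b => rwRate d c₀ qmin ^ l1N N (btgt b) s / qmin) x
  rw [← e, Finset.mul_sum]
  have e1 : (2 * d * c₀ ^ 2 + qmin)⁻¹ * m x =
      ∑ s, m s * ((2 * d * c₀ ^ 2 + qmin)⁻¹ * (if x = s then (1 : ℝ) else 0)) := by
    rw [Finset.sum_eq_single x (fun s _ hs => by rw [if_neg (Ne.symm hs)]; ring)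
      (fun h => absurd (Finset.mem_univ x) h)]
    simp only [if_true]
    ring
  rw [e1, ← Finset.sum_add_distrib]
  refine Finset.sum_le_sum fun s _ => ?_
  have h := mul_le_mul_of_nonneg_left (superSol (N := N) c₀ hq s x) (hm s)
  have : (2 * d * c₀ ^ 2 + qmin)⁻¹ * c₀ ^ 2 * (m s *
      nb2 (fun b => rwRate d c₀ qmin ^ l1N N (bsrc b) s / qmin)
        (fun b => rwRate d c₀ qmin ^ l1N N (btgt b) s / qmin) x) =
      m s * ((2 * d * c₀ ^ 2 + qmin)⁻¹ * c₀ ^ 2 *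
        nb2 (fun b => rwRate d c₀ qmin ^ l1N N (bsrc b) s / qmin)
          (fun b => rwRate d c₀ qmin ^ l1N N (btgt b) s / qmin) x) := by ring
  rw [this, ← mul_add]
  exact h

/-- **The one-scale random-walk bound for the Dirichlet resolvent**, fibrewise: for q ≥ q_min > 0, orthogonal
R(U(b)) and a characteristic function Ω₀, the solution of (Ω₀(Δ_U + M_q)Ω₀ + (1 − Ω₀))F = Ω₀μ obeys
‖F(x, ·)‖₂ ≤ q_min^{−1} Σ_s r^{d₁(x, s)}‖μ(s, ·)‖₂ with r = 2dc₀²/(2dc₀² + q_min) — the sum over the walks from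
the sources s to x, each step weighted by θ₀c₀² and each visit to a site by the inverse diagonal; established
by comparison with the geometric supersolution (no series, no smallness beyond q_min > 0). [folklore] -/
theorem resolvent_fib_le (c₀ : ℝ) (Rm : UT N × Fin d → Cp → Cp → ℝ)
    (hRm : ∀ b i j, ∑ k, Rm b k i * Rm b k j = if i = j then 1 else 0) (q : UT N × Cp → ℝ) {qmin : ℝ}
    (hqmin : 0 < qmin) (hq : ∀ p, qmin ≤ q p) {χ : UT N → ℝ} (hχ01 : ∀ x, χ x = 0 ∨ χ x = 1)
    (μ : UT N × Cp → ℝ) (x : UT N) :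
    ‖fibVec (Ring.inverse (mulOp (χ ∘ Prod.fst) * (covDT bsrc btgt (fun _ : UT N × Fin d => c₀) Rm ∘ₗ
        covD bsrc btgt (fun _ : UT N × Fin d => c₀) Rm + mulOp q) * mulOp (χ ∘ Prod.fst) +
        mulOp (1 - χ ∘ Prod.fst) : Module.End ℝ (UT N × Cp → ℝ)) (mulOp (χ ∘ Prod.fst) μ)) x‖ ≤
      ∑ s, ‖fibVec μ s‖ * (rwRate d c₀ qmin ^ l1N N x s / qmin) := by
  set S : Module.End ℝ (UT N × Cp → ℝ) := mulOp (χ ∘ Prod.fst) *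
      (covDT bsrc btgt (fun _ : UT N × Fin d => c₀) Rm ∘ₗ covD bsrc btgt (fun _ : UT N × Fin d => c₀) Rm +
        mulOp q) * mulOp (χ ∘ Prod.fst) + mulOp (1 - χ ∘ Prod.fst) with hS
  have hqpos : ∀ p, 0 < q p := fun p => lt_of_lt_of_le hqmin (hq p)
  have hχ' : ∀ p : UT N × Cp, (χ ∘ Prod.fst) p = 0 ∨ (χ ∘ Prod.fst) p = 1 := fun p => hχ01 p.1
  have hSpos : ∀ f : UT N × Cp → ℝ, f ≠ 0 → 0 < ∑ p, f p * S f p :=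
    posDef_sandwich (posDef_covLap_add_mulOp bsrc btgt (fun _ : UT N × Fin d => c₀) Rm hqpos) hχ'
      (compl_add (χ ∘ Prod.fst))
  have hSF : S (Ring.inverse S (mulOp (χ ∘ Prod.fst) μ)) = mulOp (χ ∘ Prod.fst) μ := by
    have h := LinearMap.congr_fun (mul_inverse_of_posDef hSpos) (mulOp (χ ∘ Prod.fst) μ)
    rwa [Module.End.mul_apply, Module.End.one_apply] at h
  have ha : 0 ≤ (2 * d * c₀ ^ 2 + qmin)⁻¹ * c₀ ^ 2 := by positivity
  have ha1 : (2 * d * c₀ ^ 2 + qmin)⁻¹ * c₀ ^ 2 * (2 * d) < 1 := by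
    rw [theta_mul]; exact rwRate_lt_one d c₀ hqmin
  exact comparison (N := N) ha ha1
    (fun z => ‖fibVec (Ring.inverse S (mulOp (χ ∘ Prod.fst) μ)) z‖)
    (fun z => ∑ s, ‖fibVec μ s‖ * (rwRate d c₀ qmin ^ l1N N z s / qmin))
    (fun z => (2 * d * c₀ ^ 2 + qmin)⁻¹ * ‖fibVec μ z‖)
    (fun z => subSol c₀ Rm hRm q hqmin hq hχ01 (by rw [hS] at hSF; exact hSF) z)
    (fun z => superSol_sum c₀ hqmin (fun s => ‖fibVec μ s‖) (fun s => norm_nonneg _) z) x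

/-- **The fibrewise bound for the Dirichlet local inverse** G′ = `dirInv (Δ_U + M_q) Ω₀` = Ω₀(…)^{−1}Ω₀:
‖(G′μ)(x, ·)‖₂ ≤ q_min^{−1} Σ_s r^{d₁(x, s)} ‖μ(s, ·)‖₂. [cite: Balaban1985BackgroundPropagators, p.394 + p.395; Balaban1984PropagatorsII, (2.64)–(2.66) p.234] -/
theorem dirInv_fib_le (c₀ : ℝ) (Rm : UT N × Fin d → Cp → Cp → ℝ)
    (hRm : ∀ b i j, ∑ k, Rm b k i * Rm b k j = if i = j then 1 else 0) (q : UT N × Cp → ℝ) {qmin : ℝ}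
    (hqmin : 0 < qmin) (hq : ∀ p, qmin ≤ q p) {χ : UT N → ℝ} (hχ01 : ∀ x, χ x = 0 ∨ χ x = 1)
    (μ : UT N × Cp → ℝ) (x : UT N) :
    ‖fibVec (dirInv (covDT bsrc btgt (fun _ : UT N × Fin d => c₀) Rm ∘ₗ
        covD bsrc btgt (fun _ : UT N × Fin d => c₀) Rm + mulOp q) (χ ∘ Prod.fst) μ) x‖ ≤
      ∑ s, ‖fibVec μ s‖ * (rwRate d c₀ qmin ^ l1N N x s / qmin) := by
  have e : dirInv (covDT bsrc btgt (fun _ : UT N × Fin d => c₀) Rm ∘ₗ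
        covD bsrc btgt (fun _ : UT N × Fin d => c₀) Rm + mulOp q) (χ ∘ Prod.fst) μ =
      mulOp (χ ∘ Prod.fst) (Ring.inverse (mulOp (χ ∘ Prod.fst) *
        (covDT bsrc btgt (fun _ : UT N × Fin d => c₀) Rm ∘ₗ covD bsrc btgt (fun _ : UT N × Fin d => c₀) Rm +
          mulOp q) * mulOp (χ ∘ Prod.fst) + mulOp (1 - χ ∘ Prod.fst) : Module.End ℝ (UT N × Cp → ℝ))
          (mulOp (χ ∘ Prod.fst) μ)) := rfl
  rw [e, norm_fibVec_mulOp_comp_fst]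
  have h1 : |χ x| ≤ 1 := by rcases hχ01 x with h | h <;> simp [h]
  calc |χ x| * _ ≤ 1 * _ := mul_le_mul_of_nonneg_right h1 (norm_nonneg _)
    _ = _ := one_mul _
    _ ≤ _ := resolvent_fib_le c₀ Rm hRm q hqmin hq hχ01 μ x

/-- **Located source**: for μ carried by the fibre over one point y′ with components bounded by B,
‖(G′μ)(x, ·)‖₂ ≤ √|Cp|·B·r^{d₁(x, y′)}/q_min. [cite: Balaban1985BackgroundPropagators, p.394; Balaban1984PropagatorsII, (2.51) p.232 + (2.46) p.231] -/
theorem dirInv_fib_le_of_supp (c₀ : ℝ) (Rm : UT N × Fin d → Cp → Cp → ℝ)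
    (hRm : ∀ b i j, ∑ k, Rm b k i * Rm b k j = if i = j then 1 else 0) (q : UT N × Cp → ℝ) {qmin : ℝ}
    (hqmin : 0 < qmin) (hq : ∀ p, qmin ≤ q p) {χ : UT N → ℝ} (hχ01 : ∀ x, χ x = 0 ∨ χ x = 1)
    {μ : UT N × Cp → ℝ} {y' : UT N} {B : ℝ} (hB : 0 ≤ B) (hbd : ∀ p : UT N × Cp, p.1 = y' → |μ p| ≤ B)
    (hoff : ∀ p : UT N × Cp, p.1 ≠ y' → μ p = 0) (x : UT N) :
    ‖fibVec (dirInv (covDT bsrc btgt (fun _ : UT N × Fin d => c₀) Rm ∘ₗ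
        covD bsrc btgt (fun _ : UT N × Fin d => c₀) Rm + mulOp q) (χ ∘ Prod.fst) μ) x‖ ≤
      Real.sqrt (Fintype.card Cp) * B * (rwRate d c₀ qmin ^ l1N N x y' / qmin) := by
  refine (dirInv_fib_le c₀ Rm hRm q hqmin hq hχ01 μ x).trans ?_
  rw [Finset.sum_eq_single y']
  · exact mul_le_mul_of_nonneg_right (norm_fibVec_le_sqrt_card μ y' hB fun i => hbd (y', i) rfl)
      (div_nonneg (pow_nonneg (rwRate_nonneg d c₀ hqmin) _) hqmin.le)
  · intro s _ hs
    have : fibVec μ s = 0 := by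
      ext i
      simp [fibVec, hoff (s, i) hs]
    rw [this, norm_zero, zero_mul]
  · exact fun h => absurd (Finset.mem_univ y') h

end Resolvent

/-! ## §7  Corollary-3.6-type entries for the Dirichlet local inverses G′_□ = `dirInv (Δ_U + M_q) Ω₀(□)`:
the hypotheses `h342_1` … `h342_4` of `B9Thm37GlueTorusInv` DISCHARGED in the one-scale ℓ¹ torus model -/

section Discharge

variable {d : ℕ} {N : Fin d → ℕ} [∀ i, NeZero (N i)] {Cp : Type} [Fintype Cp] [DecidableEq Cp]

omit [∀ i, NeZero (N i)] in
/-- A rotated component is bounded by the fibre norm: |Σ_j R(b)_{kj} g(y, j)| ≤ ‖g(y, ·)‖₂. [folklore] -/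
theorem abs_sum_Rm_mul_le (Rm : UT N × Fin d → Cp → Cp → ℝ)
    (hRm : ∀ b i j, ∑ k, Rm b k i * Rm b k j = if i = j then 1 else 0) (b : UT N × Fin d) {Y : Type}
    (g : Y × Cp → ℝ) (y : Y) (k : Cp) : |∑ j, Rm b k j * g (y, j)| ≤ ‖fibVec g y‖ := by
  have h := PiLp.norm_apply_le (act Rm b (fibVec g y)) k
  rw [Real.norm_eq_abs, norm_act Rm hRm b g y] at h
  exact h

omit [DecidableEq Cp] in
/-- The adjoint covariant derivative at a point as a sum of (rotated) bond fibre vectors. [cite: Balaban1985BackgroundPropagators, (3.8) p.392] -/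
theorem fibVec_covDT (c₀ : ℝ) (Rm : UT N × Fin d → Cp → Cp → ℝ) (μ : (UT N × Fin d) × Cp → ℝ) (s : UT N) :
    fibVec (covDT bsrc btgt (fun _ : UT N × Fin d => c₀) Rm μ) s =
      ∑ b : UT N × Fin d, ((if btgt b = s then c₀ • actT Rm b (fibVec μ b) else 0) -
        (if bsrc b = s then c₀ • fibVec μ b else 0)) := by
  ext i
  simp only [fibVec_apply, covDT_apply, WithLp.ofLp_sum, WithLp.ofLp_sub, Finset.sum_apply, Pi.sub_apply]
  refine Finset.sum_congr rfl fun b _ => ?_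
  by_cases h1 : btgt b = s <;> by_cases h2 : bsrc b = s <;> simp [h1, h2, actT, fibVec]

/-- **Fibre bound of D\***: ‖(D\*μ)(s, ·)‖₂ ≤ |c₀|(Σ_{b₊ = s} ‖μ(b, ·)‖₂ + Σ_{b₋ = s} ‖μ(b, ·)‖₂) for orthogonal R(U(b)). [cite: Balaban1985BackgroundPropagators, (3.8) p.392] -/
theorem norm_fibVec_covDT_le (c₀ : ℝ) (Rm : UT N × Fin d → Cp → Cp → ℝ)
    (hRm : ∀ b i j, ∑ k, Rm b k i * Rm b k j = if i = j then 1 else 0) (μ : (UT N × Fin d) × Cp → ℝ)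
    (s : UT N) :
    ‖fibVec (covDT bsrc btgt (fun _ : UT N × Fin d => c₀) Rm μ) s‖ ≤
      |c₀| * nb2 (fun b => ‖fibVec μ b‖) (fun b => ‖fibVec μ b‖) s := by
  rw [fibVec_covDT]
  refine (norm_sum_le _ _).trans ?_
  have e : |c₀| * nb2 (fun b => ‖fibVec μ b‖) (fun b => ‖fibVec μ b‖) s =
      ∑ b : UT N × Fin d, ((if btgt b = s then |c₀| * ‖fibVec μ b‖ else 0) +
        (if bsrc b = s then |c₀| * ‖fibVec μ b‖ else 0)) := by
    unfold nb2
    rw [Finset.mul_sum]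
    exact Finset.sum_congr rfl fun b _ => by split_ifs <;> ring
  rw [e]
  refine Finset.sum_le_sum fun b _ => (norm_sub_le _ _).trans (add_le_add ?_ ?_)
  · split_ifs
    · rw [norm_smul, Real.norm_eq_abs, norm_actT Rm hRm b μ b]
    · rw [norm_zero]
  · split_ifs
    · rw [norm_smul, Real.norm_eq_abs]
    · rw [norm_zero]

/-- **`h342_1` DISCHARGED — entry 1 of (3.42) for the Dirichlet local inverses** G′_□ = `dirInv (Δ_U + M_q) Ω₀(□)`
in the one-scale ℓ¹ torus model (massive case q ≥ q_min > 0, orthogonal R(U(b)), Ω₀(□) = χ_□ any characteristic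
function): |(G′_□λ)(x)| ≤ B₀η²e^{−δ₀d₁(x, y′)}|λ| for supp λ in the fibre over y′, with any B₀η² ≥ √|Cp|/q_min and any
δ₀ with 2dc₀²/(2dc₀² + q_min) ≤ e^{−δ₀} (cf. `exists_rate`) — by the random-walk comparison `dirInv_fib_le`.
[cite: Balaban1985BackgroundPropagators, (3.42) p.397 + Cor 3.6 p.409 + p.394; Balaban1984PropagatorsII, (2.46) p.231 + (2.51) p.232] -/
theorem h342_1_rw (η L M R : ℝ) (H : Prop) (c₀ : ℝ) (Rm : UT N × Fin d → Cp → Cp → ℝ)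
    (hRm : ∀ b i j, ∑ k, Rm b k i * Rm b k j = if i = j then 1 else 0) (q : UT N × Cp → ℝ) {qmin : ℝ}
    (hqmin : 0 < qmin) (hq : ∀ p, qmin ≤ q p) {δ₀ B₀ : ℝ} (hre : rwRate d c₀ qmin ≤ Real.exp (-δ₀))
    (hB : Real.sqrt (Fintype.card Cp) / qmin ≤ B₀ * η ^ 2)
    {ι : Type} {χ : ι → UT N → ℝ} (hχ01 : ∀ i x, χ i x = 0 ∨ χ i x = 1) :
    ∀ i, HasMajorant (g := toB6 (torusGeom N η L M) R H) (cblk (chart0 N η L M))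
      (dirInv (covDT bsrc btgt (fun _ : UT N × Fin d => c₀) Rm ∘ₗ covD bsrc btgt (fun _ : UT N × Fin d => c₀) Rm +
        mulOp q) (χ i ∘ Prod.fst))
      (fun a b => B₀ * η ^ 2 * Real.exp (-(δ₀ * tdist1 N a b))) := by
  intro i y' μ B hμ p
  change UT N at y'
  obtain ⟨x, k⟩ := p
  set G := dirInv (covDT bsrc btgt (fun _ : UT N × Fin d => c₀) Rm ∘ₗ
    covD bsrc btgt (fun _ : UT N × Fin d => c₀) Rm + mulOp q) (χ i ∘ Prod.fst) with hG
  show |G μ (x, k)| ≤ B₀ * η ^ 2 * Real.exp (-(δ₀ * tdist1 N x y')) * B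
  have hB0 : 0 ≤ B := hμ.nonneg
  have hr0 : 0 ≤ rwRate d c₀ qmin := rwRate_nonneg d c₀ hqmin
  have hU : ‖fibVec (G μ) x‖ ≤ Real.sqrt (Fintype.card Cp) * B * (rwRate d c₀ qmin ^ l1N N x y' / qmin) :=
    dirInv_fib_le_of_supp c₀ Rm hRm q hqmin hq (hχ01 i) hB0 (fun p hp => hμ.bound p hp)
      (fun p hp => hμ.off p hp) x
  have e0 : rwRate d c₀ qmin ^ l1N N x y' ≤ Real.exp (-(δ₀ * tdist1 N x y')) := by
    rw [tdist1_eq_cast]; exact pow_le_exp_neg hr0 hre _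
  calc |G μ (x, k)| ≤ ‖fibVec (G μ) x‖ := abs_le_norm_fibVec _ x k
    _ ≤ Real.sqrt (Fintype.card Cp) * B * (rwRate d c₀ qmin ^ l1N N x y' / qmin) := hU
    _ ≤ Real.sqrt (Fintype.card Cp) * B * (Real.exp (-(δ₀ * tdist1 N x y')) / qmin) :=
        mul_le_mul_of_nonneg_left (div_le_div_of_nonneg_right e0 hqmin.le) (mul_nonneg (Real.sqrt_nonneg _) hB0)
    _ = Real.sqrt (Fintype.card Cp) / qmin * Real.exp (-(δ₀ * tdist1 N x y')) * B := by ring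
    _ ≤ B₀ * η ^ 2 * Real.exp (-(δ₀ * tdist1 N x y')) * B :=
        mul_le_mul_of_nonneg_right (mul_le_mul_of_nonneg_right hB (Real.exp_pos _).le) hB0

/-- **`h342_2` DISCHARGED — entry 2 of (3.42) (|∇_U G′_□|, weight η) for the Dirichlet local inverses** in the
one-scale ℓ¹ torus model: |(D G′_□λ)(b)| ≤ B₀ηe^{−δ₀d₁(b₋, y′)}|λ| (bond located at its source) with any
B₀η ≥ |c₀|√|Cp|(1 + e^{δ₀})/q_min — the two ends of the bond are at distance ≤ 1, costing the factor e^{δ₀}.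
[cite: Balaban1985BackgroundPropagators, (3.42) p.397 + Cor 3.6 p.409 + (3.3) pp.390–391; Balaban1984PropagatorsII, (2.46) p.231 + (2.51) p.232] -/
theorem h342_2_rw (η L M R : ℝ) (H : Prop) (c₀ : ℝ) (Rm : UT N × Fin d → Cp → Cp → ℝ)
    (hRm : ∀ b i j, ∑ k, Rm b k i * Rm b k j = if i = j then 1 else 0) (q : UT N × Cp → ℝ) {qmin : ℝ}
    (hqmin : 0 < qmin) (hq : ∀ p, qmin ≤ q p) {δ₀ B₀ : ℝ} (hδ₀ : 0 ≤ δ₀)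
    (hre : rwRate d c₀ qmin ≤ Real.exp (-δ₀))
    (hB : |c₀| * Real.sqrt (Fintype.card Cp) * (1 + Real.exp δ₀) / qmin ≤ B₀ * η)
    {ι : Type} {χ : ι → UT N → ℝ} (hχ01 : ∀ i x, χ i x = 0 ∨ χ i x = 1) :
    ∀ i, HasMajorantHom (g := toB6 (torusGeom N η L M) R H) (cblk (chart0 N η L M)) (cblkY (chart0 N η L M))
      (covD bsrc btgt (fun _ : UT N × Fin d => c₀) Rm ∘ₗ
        dirInv (covDT bsrc btgt (fun _ : UT N × Fin d => c₀) Rm ∘ₗ covD bsrc btgt (fun _ : UT N × Fin d => c₀) Rm +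
        mulOp q) (χ i ∘ Prod.fst))
      (fun a b => B₀ * η * Real.exp (-(δ₀ * tdist1 N a b))) := by
  intro i y' μ B hμ v
  change UT N at y'
  obtain ⟨⟨z, ν⟩, k⟩ := v
  set G := dirInv (covDT bsrc btgt (fun _ : UT N × Fin d => c₀) Rm ∘ₗ
    covD bsrc btgt (fun _ : UT N × Fin d => c₀) Rm + mulOp q) (χ i ∘ Prod.fst) with hG
  show |c₀ * (∑ j, Rm (z, ν) k j * G μ (up z ν, j) - G μ (z, k))| ≤
    B₀ * η * Real.exp (-(δ₀ * tdist1 N z y')) * B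
  have hB0 : 0 ≤ B := hμ.nonneg
  have hr0 : 0 ≤ rwRate d c₀ qmin := rwRate_nonneg d c₀ hqmin
  have hU : ∀ s, ‖fibVec (G μ) s‖ ≤ Real.sqrt (Fintype.card Cp) * B * (rwRate d c₀ qmin ^ l1N N s y' / qmin) :=
    fun s => dirInv_fib_le_of_supp c₀ Rm hRm q hqmin hq (hχ01 i) hB0 (fun p hp => hμ.bound p hp)
      (fun p hp => hμ.off p hp) s
  have e0 : rwRate d c₀ qmin ^ l1N N z y' ≤ Real.exp (-(δ₀ * tdist1 N z y')) := by
    rw [tdist1_eq_cast]; exact pow_le_exp_neg hr0 hre _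
  have e1 : rwRate d c₀ qmin ^ l1N N (up z ν) y' ≤ Real.exp δ₀ * Real.exp (-(δ₀ * tdist1 N z y')) := by
    rw [tdist1_eq_cast]; exact pow_le_exp_neg_shift hr0 hre hδ₀ (l1N_le_up_add z y' ν)
  have h1 : |∑ j, Rm (z, ν) k j * G μ (up z ν, j)| ≤ ‖fibVec (G μ) (up z ν)‖ :=
    abs_sum_Rm_mul_le Rm hRm (z, ν) (G μ) (up z ν) k
  have h2 : |G μ (z, k)| ≤ ‖fibVec (G μ) z‖ := abs_le_norm_fibVec _ z k
  have hC0 : 0 ≤ Real.sqrt (Fintype.card Cp) * B := mul_nonneg (Real.sqrt_nonneg _) hB0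
  calc |c₀ * (∑ j, Rm (z, ν) k j * G μ (up z ν, j) - G μ (z, k))|
      = |c₀| * |∑ j, Rm (z, ν) k j * G μ (up z ν, j) - G μ (z, k)| := abs_mul _ _
    _ ≤ |c₀| * (‖fibVec (G μ) (up z ν)‖ + ‖fibVec (G μ) z‖) :=
        mul_le_mul_of_nonneg_left ((abs_sub _ _).trans (add_le_add h1 h2)) (abs_nonneg _)
    _ ≤ |c₀| * (Real.sqrt (Fintype.card Cp) * B * (Real.exp δ₀ * Real.exp (-(δ₀ * tdist1 N z y')) / qmin) +
          Real.sqrt (Fintype.card Cp) * B * (Real.exp (-(δ₀ * tdist1 N z y')) / qmin)) := by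
        refine mul_le_mul_of_nonneg_left (add_le_add ((hU _).trans ?_) ((hU _).trans ?_)) (abs_nonneg _)
        · exact mul_le_mul_of_nonneg_left (div_le_div_of_nonneg_right e1 hqmin.le) hC0
        · exact mul_le_mul_of_nonneg_left (div_le_div_of_nonneg_right e0 hqmin.le) hC0
    _ = |c₀| * Real.sqrt (Fintype.card Cp) * (1 + Real.exp δ₀) / qmin * Real.exp (-(δ₀ * tdist1 N z y')) * B := by
        ring
    _ ≤ B₀ * η * Real.exp (-(δ₀ * tdist1 N z y')) * B :=
        mul_le_mul_of_nonneg_right (mul_le_mul_of_nonneg_right hB (Real.exp_pos _).le) hB0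

/-- **`h342_4` DISCHARGED — entry 4 of (3.42) (|Δ_U G′_□|, weight 1) for the Dirichlet local inverses** in the
one-scale ℓ¹ torus model: |(Δ_U G′_□λ)(x)| ≤ B₀e^{−δ₀d₁(x, y′)}|λ| with any B₀ ≥ 2dc₀²√|Cp|(1 + e^{δ₀})/q_min — the
diagonal 2dc₀² and the 2d neighbours at distance 1.
[cite: Balaban1985BackgroundPropagators, (3.42) p.397 + Cor 3.6 p.409 + (3.23) p.394 + (3.8) p.392; Balaban1984PropagatorsII, (2.46) p.231 + (2.51) p.232] -/
theorem h342_4_rw (η L M R : ℝ) (H : Prop) (c₀ : ℝ) (Rm : UT N × Fin d → Cp → Cp → ℝ)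
    (hRm : ∀ b i j, ∑ k, Rm b k i * Rm b k j = if i = j then 1 else 0) (q : UT N × Cp → ℝ) {qmin : ℝ}
    (hqmin : 0 < qmin) (hq : ∀ p, qmin ≤ q p) {δ₀ B₀ : ℝ} (hδ₀ : 0 ≤ δ₀)
    (hre : rwRate d c₀ qmin ≤ Real.exp (-δ₀))
    (hB : 2 * d * c₀ ^ 2 * Real.sqrt (Fintype.card Cp) * (1 + Real.exp δ₀) / qmin ≤ B₀)
    {ι : Type} {χ : ι → UT N → ℝ} (hχ01 : ∀ i x, χ i x = 0 ∨ χ i x = 1) :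
    ∀ i, HasMajorantHom (g := toB6 (torusGeom N η L M) R H) (cblk (chart0 N η L M)) (cblk (chart0 N η L M))
      ((covDT bsrc btgt (fun _ : UT N × Fin d => c₀) Rm ∘ₗ covD bsrc btgt (fun _ : UT N × Fin d => c₀) Rm) ∘ₗ
        dirInv (covDT bsrc btgt (fun _ : UT N × Fin d => c₀) Rm ∘ₗ covD bsrc btgt (fun _ : UT N × Fin d => c₀) Rm +
        mulOp q) (χ i ∘ Prod.fst))
      (fun a b => B₀ * Real.exp (-(δ₀ * tdist1 N a b))) := by
  intro i y' μ B hμ p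
  change UT N at y'
  obtain ⟨x, k⟩ := p
  set G := dirInv (covDT bsrc btgt (fun _ : UT N × Fin d => c₀) Rm ∘ₗ
    covD bsrc btgt (fun _ : UT N × Fin d => c₀) Rm + mulOp q) (χ i ∘ Prod.fst) with hG
  show |(covDT bsrc btgt (fun _ : UT N × Fin d => c₀) Rm ∘ₗ covD bsrc btgt (fun _ : UT N × Fin d => c₀) Rm)
      (G μ) (x, k)| ≤ B₀ * Real.exp (-(δ₀ * tdist1 N x y')) * B
  rw [covLap_apply c₀ Rm hRm]
  have hB0 : 0 ≤ B := hμ.nonneg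
  have hr0 : 0 ≤ rwRate d c₀ qmin := rwRate_nonneg d c₀ hqmin
  have hU : ∀ s, ‖fibVec (G μ) s‖ ≤ Real.sqrt (Fintype.card Cp) * B * (rwRate d c₀ qmin ^ l1N N s y' / qmin) :=
    fun s => dirInv_fib_le_of_supp c₀ Rm hRm q hqmin hq (hχ01 i) hB0 (fun p hp => hμ.bound p hp)
      (fun p hp => hμ.off p hp) s
  have hC0 : 0 ≤ Real.sqrt (Fintype.card Cp) * B := mul_nonneg (Real.sqrt_nonneg _) hB0
  have e0 : rwRate d c₀ qmin ^ l1N N x y' ≤ Real.exp (-(δ₀ * tdist1 N x y')) := by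
    rw [tdist1_eq_cast]; exact pow_le_exp_neg hr0 hre _
  have ein : ∀ (z : UT N) (ν : Fin d), up z ν = x →
      rwRate d c₀ qmin ^ l1N N z y' ≤ Real.exp δ₀ * Real.exp (-(δ₀ * tdist1 N x y')) := fun z ν hz => by
    rw [tdist1_eq_cast, ← hz]; exact pow_le_exp_neg_shift hr0 hre hδ₀ (l1N_up_le_add z y' ν)
  have eout : ∀ ν : Fin d,
      rwRate d c₀ qmin ^ l1N N (up x ν) y' ≤ Real.exp δ₀ * Real.exp (-(δ₀ * tdist1 N x y')) := fun ν => by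
    rw [tdist1_eq_cast]; exact pow_le_exp_neg_shift hr0 hre hδ₀ (l1N_le_up_add x y' ν)
  have h1 : |G μ (x, k)| ≤ ‖fibVec (G μ) x‖ := abs_le_norm_fibVec _ x k
  have h2 : |hopT Rm (G μ) (x, k)| ≤
      nb2 (fun b => ‖fibVec (G μ) (bsrc b)‖) (fun b => ‖fibVec (G μ) (btgt b)‖) x :=
    (abs_le_norm_fibVec (hopT Rm (G μ)) x k).trans (norm_fibVec_hopT_le Rm hRm (G μ) x)
  have hnb : nb2 (fun b => ‖fibVec (G μ) (bsrc b)‖) (fun b => ‖fibVec (G μ) (btgt b)‖) x ≤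
      d * (Real.sqrt (Fintype.card Cp) * B * (Real.exp δ₀ * Real.exp (-(δ₀ * tdist1 N x y')) / qmin)) +
        d * (Real.sqrt (Fintype.card Cp) * B * (Real.exp δ₀ * Real.exp (-(δ₀ * tdist1 N x y')) / qmin)) := by
    refine nb2_le (fun b hb => ?_) (fun b hb => ?_)
    · obtain ⟨z, ν⟩ := b
      simp only [btgt_apply] at hb
      exact (hU z).trans (mul_le_mul_of_nonneg_left (div_le_div_of_nonneg_right (ein z ν hb) hqmin.le) hC0)
    · obtain ⟨z, ν⟩ := b
      simp only [bsrc_apply] at hb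
      subst hb
      exact (hU _).trans (mul_le_mul_of_nonneg_left (div_le_div_of_nonneg_right (eout ν) hqmin.le) hC0)
  calc |c₀ ^ 2 * (2 * d) * G μ (x, k) - c₀ ^ 2 * hopT Rm (G μ) (x, k)|
      ≤ |c₀ ^ 2 * (2 * d) * G μ (x, k)| + |c₀ ^ 2 * hopT Rm (G μ) (x, k)| := abs_sub _ _
    _ = c₀ ^ 2 * (2 * d) * |G μ (x, k)| + c₀ ^ 2 * |hopT Rm (G μ) (x, k)| := by
        rw [abs_mul, abs_of_nonneg (by positivity : (0 : ℝ) ≤ c₀ ^ 2 * (2 * d)), abs_mul,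
          abs_of_nonneg (sq_nonneg c₀)]
    _ ≤ c₀ ^ 2 * (2 * d) * (Real.sqrt (Fintype.card Cp) * B * (Real.exp (-(δ₀ * tdist1 N x y')) / qmin)) +
        c₀ ^ 2 * (d * (Real.sqrt (Fintype.card Cp) * B * (Real.exp δ₀ * Real.exp (-(δ₀ * tdist1 N x y')) / qmin)) +
          d * (Real.sqrt (Fintype.card Cp) * B * (Real.exp δ₀ * Real.exp (-(δ₀ * tdist1 N x y')) / qmin))) := by
        refine add_le_add ?_ ?_
        · exact mul_le_mul_of_nonneg_left
            (h1.trans ((hU x).trans (mul_le_mul_of_nonneg_left (div_le_div_of_nonneg_right e0 hqmin.le) hC0)))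
            (by positivity)
        · exact mul_le_mul_of_nonneg_left (h2.trans hnb) (sq_nonneg c₀)
    _ = 2 * d * c₀ ^ 2 * Real.sqrt (Fintype.card Cp) * (1 + Real.exp δ₀) / qmin *
          Real.exp (-(δ₀ * tdist1 N x y')) * B := by ring
    _ ≤ B₀ * Real.exp (-(δ₀ * tdist1 N x y')) * B :=
        mul_le_mul_of_nonneg_right (mul_le_mul_of_nonneg_right hB (Real.exp_pos _).le) hB0

/-- **`h342_3` DISCHARGED — entry 3 of (3.42) (|G′_□∇*_U|, weight η) for the Dirichlet local inverses** in the
one-scale ℓ¹ torus model: |(G′_□ D*λ)(x)| ≤ B₀ηe^{−δ₀d₁(x, y′)}|λ| for supp λ in the bond fibres over the source point y′,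
with any B₀η ≥ d|c₀|√|Cp|(1 + e^{δ₀})/q_min — the d bonds leaving y′ feed the walk at y′ and at its neighbours.
[cite: Balaban1985BackgroundPropagators, (3.42) p.397 + Cor 3.6 p.409 + (3.3) pp.390–391; Balaban1984PropagatorsII, (2.46) p.231 + (2.51) p.232] -/
theorem h342_3_rw (η L M R : ℝ) (H : Prop) (c₀ : ℝ) (Rm : UT N × Fin d → Cp → Cp → ℝ)
    (hRm : ∀ b i j, ∑ k, Rm b k i * Rm b k j = if i = j then 1 else 0) (q : UT N × Cp → ℝ) {qmin : ℝ}
    (hqmin : 0 < qmin) (hq : ∀ p, qmin ≤ q p) {δ₀ B₀ : ℝ} (hδ₀ : 0 ≤ δ₀)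
    (hre : rwRate d c₀ qmin ≤ Real.exp (-δ₀))
    (hB : d * |c₀| * Real.sqrt (Fintype.card Cp) * (1 + Real.exp δ₀) / qmin ≤ B₀ * η)
    {ι : Type} {χ : ι → UT N → ℝ} (hχ01 : ∀ i x, χ i x = 0 ∨ χ i x = 1) :
    ∀ i, HasMajorantHom (g := toB6 (torusGeom N η L M) R H) (cblkY (chart0 N η L M)) (cblk (chart0 N η L M))
      (dirInv (covDT bsrc btgt (fun _ : UT N × Fin d => c₀) Rm ∘ₗ covD bsrc btgt (fun _ : UT N × Fin d => c₀) Rm +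
        mulOp q) (χ i ∘ Prod.fst) ∘ₗ covDT bsrc btgt (fun _ : UT N × Fin d => c₀) Rm)
      (fun a b => B₀ * η * Real.exp (-(δ₀ * tdist1 N a b))) := by
  intro i y' μ B hμ p
  change UT N at y'
  obtain ⟨x, k⟩ := p
  set G := dirInv (covDT bsrc btgt (fun _ : UT N × Fin d => c₀) Rm ∘ₗ
    covD bsrc btgt (fun _ : UT N × Fin d => c₀) Rm + mulOp q) (χ i ∘ Prod.fst) with hG
  show |G (covDT bsrc btgt (fun _ : UT N × Fin d => c₀) Rm μ) (x, k)| ≤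
    B₀ * η * Real.exp (-(δ₀ * tdist1 N x y')) * B
  have hB0 : 0 ≤ B := hμ.nonneg
  have hr0 : 0 ≤ rwRate d c₀ qmin := rwRate_nonneg d c₀ hqmin
  have hC0 : 0 ≤ Real.sqrt (Fintype.card Cp) * B := mul_nonneg (Real.sqrt_nonneg _) hB0
  -- the source: bond fibre vectors vanish off the bonds leaving y′ and have norm ≤ √|Cp|·B on them
  have hμb : ∀ b : UT N × Fin d, ‖fibVec μ b‖ ≤ if bsrc b = y' then Real.sqrt (Fintype.card Cp) * B else 0 :=
    fun b => by
      split_ifs with hb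
      · exact norm_fibVec_le_sqrt_card μ b hB0 fun j => hμ.bound (b, j) hb
      · have : fibVec μ b = 0 := by
          ext j
          simp [fibVec, hμ.off (b, j) hb]
        rw [this, norm_zero]
  -- decay factors at y′ and at the far ends of the bonds leaving y′
  have e0 : rwRate d c₀ qmin ^ l1N N x y' ≤ Real.exp (-(δ₀ * tdist1 N x y')) := by
    rw [tdist1_eq_cast]; exact pow_le_exp_neg hr0 hre _
  have e1 : ∀ ν : Fin d,
      rwRate d c₀ qmin ^ l1N N x (up y' ν) ≤ Real.exp δ₀ * Real.exp (-(δ₀ * tdist1 N x y')) := fun ν => by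
    rw [tdist1_eq_cast, l1N_comm x (up y' ν), l1N_comm x y']
    exact pow_le_exp_neg_shift hr0 hre hδ₀ (l1N_le_up_add y' x ν)
  -- step 1: the walk bound for the source D*μ
  have h1 : |G (covDT bsrc btgt (fun _ : UT N × Fin d => c₀) Rm μ) (x, k)| ≤
      ∑ s, ‖fibVec (covDT bsrc btgt (fun _ : UT N × Fin d => c₀) Rm μ) s‖ * (rwRate d c₀ qmin ^ l1N N x s / qmin) :=
    (abs_le_norm_fibVec _ x k).trans (dirInv_fib_le c₀ Rm hRm q hqmin hq (hχ01 i) _ x)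
  -- step 2: the fibre norms of D*μ are carried by y′ and its forward neighbours
  have h2 : ∑ s, ‖fibVec (covDT bsrc btgt (fun _ : UT N × Fin d => c₀) Rm μ) s‖ *
        (rwRate d c₀ qmin ^ l1N N x s / qmin) ≤
      ∑ s, (|c₀| * nb2 (fun b => if bsrc b = y' then Real.sqrt (Fintype.card Cp) * B else 0)
        (fun b => if bsrc b = y' then Real.sqrt (Fintype.card Cp) * B else 0) s) *
        (rwRate d c₀ qmin ^ l1N N x s / qmin) :=
    Finset.sum_le_sum fun s _ => mul_le_mul_of_nonneg_right
      ((norm_fibVec_covDT_le c₀ Rm hRm μ s).trans (mul_le_mul_of_nonneg_left (nb2_mono hμb hμb s) (abs_nonneg _)))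
      (div_nonneg (pow_nonneg hr0 _) hqmin.le)
  -- step 3: relocate the site weights to the bond ends
  have h3 : ∑ s, (|c₀| * nb2 (fun b => if bsrc b = y' then Real.sqrt (Fintype.card Cp) * B else 0)
        (fun b => if bsrc b = y' then Real.sqrt (Fintype.card Cp) * B else 0) s) *
        (rwRate d c₀ qmin ^ l1N N x s / qmin) =
      |c₀| * ∑ b : UT N × Fin d, ((if bsrc b = y' then Real.sqrt (Fintype.card Cp) * B else 0) *
        (rwRate d c₀ qmin ^ l1N N x (btgt b) / qmin) +
        (if bsrc b = y' then Real.sqrt (Fintype.card Cp) * B else 0) *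
        (rwRate d c₀ qmin ^ l1N N x (bsrc b) / qmin)) := by
    have e := sum_nb2_mul (N := N) (fun b => if bsrc b = y' then Real.sqrt (Fintype.card Cp) * B else 0)
      (fun b => if bsrc b = y' then Real.sqrt (Fintype.card Cp) * B else 0)
      (fun s => rwRate d c₀ qmin ^ l1N N x s / qmin)
    beta_reduce at e
    rw [← e, Finset.mul_sum]
    exact Finset.sum_congr rfl fun s _ => by ring
  -- step 4: the d bonds leaving y′
  have h4 : ∑ b : UT N × Fin d, ((if bsrc b = y' then Real.sqrt (Fintype.card Cp) * B else 0) *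
        (rwRate d c₀ qmin ^ l1N N x (btgt b) / qmin) +
        (if bsrc b = y' then Real.sqrt (Fintype.card Cp) * B else 0) *
        (rwRate d c₀ qmin ^ l1N N x (bsrc b) / qmin)) ≤
      d * (Real.sqrt (Fintype.card Cp) * B * ((Real.exp δ₀ * Real.exp (-(δ₀ * tdist1 N x y')) +
        Real.exp (-(δ₀ * tdist1 N x y'))) / qmin)) := by
    calc ∑ b : UT N × Fin d, ((if bsrc b = y' then Real.sqrt (Fintype.card Cp) * B else 0) *
          (rwRate d c₀ qmin ^ l1N N x (btgt b) / qmin) +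
          (if bsrc b = y' then Real.sqrt (Fintype.card Cp) * B else 0) *
          (rwRate d c₀ qmin ^ l1N N x (bsrc b) / qmin))
        ≤ ∑ b : UT N × Fin d, (if bsrc b = y' then Real.sqrt (Fintype.card Cp) * B *
            ((Real.exp δ₀ * Real.exp (-(δ₀ * tdist1 N x y')) + Real.exp (-(δ₀ * tdist1 N x y'))) / qmin) else 0) := by
          refine Finset.sum_le_sum fun b _ => ?_
          obtain ⟨z, ν⟩ := b
          by_cases hb : z = y'
          · subst hb
            simp only [bsrc_apply, btgt_apply, if_true]
            rw [← mul_add, ← add_div]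
            exact mul_le_mul_of_nonneg_left (div_le_div_of_nonneg_right (add_le_add (e1 ν) e0) hqmin.le) hC0
          · simp only [bsrc_apply, hb, if_false, zero_mul, add_zero, le_refl]
      _ = d * (Real.sqrt (Fintype.card Cp) * B * ((Real.exp δ₀ * Real.exp (-(δ₀ * tdist1 N x y')) +
          Real.exp (-(δ₀ * tdist1 N x y'))) / qmin)) := by
          rw [← sum_ind_src (N := N) y', Finset.sum_mul]
          exact Finset.sum_congr rfl fun b _ => by split_ifs <;> simp
  calc |G (covDT bsrc btgt (fun _ : UT N × Fin d => c₀) Rm μ) (x, k)|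
      ≤ |c₀| * ∑ b : UT N × Fin d, ((if bsrc b = y' then Real.sqrt (Fintype.card Cp) * B else 0) *
          (rwRate d c₀ qmin ^ l1N N x (btgt b) / qmin) +
          (if bsrc b = y' then Real.sqrt (Fintype.card Cp) * B else 0) *
          (rwRate d c₀ qmin ^ l1N N x (bsrc b) / qmin)) := (h1.trans h2).trans h3.le
    _ ≤ |c₀| * (d * (Real.sqrt (Fintype.card Cp) * B * ((Real.exp δ₀ * Real.exp (-(δ₀ * tdist1 N x y')) +
          Real.exp (-(δ₀ * tdist1 N x y'))) / qmin))) := mul_le_mul_of_nonneg_left h4 (abs_nonneg _)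
    _ = d * |c₀| * Real.sqrt (Fintype.card Cp) * (1 + Real.exp δ₀) / qmin * Real.exp (-(δ₀ * tdist1 N x y')) * B := by
        ring
    _ ≤ B₀ * η * Real.exp (-(δ₀ * tdist1 N x y')) * B :=
        mul_le_mul_of_nonneg_right (mul_le_mul_of_nonneg_right hB (Real.exp_pos _).le) hB0

end Discharge

/-! ## §8  Capstones: the four entries of (3.42) for G′ = (Δ_U + M_q)^{−1} on the one-scale ℓ¹ torus with the
Corollary-3.6-type inputs DISCHARGED (massive regime), and the η-scaling of the rate -/

section Capstone

variable {d : ℕ} {N : Fin d → ℕ} [∀ i, NeZero (N i)] {Cp : Type} [Fintype Cp] [DecidableEq Cp]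

/-- **Entry 1 of (3.42) for G′ = (Δ_U + M_q)^{−1} (|G′|, weight η²) on the one-scale ℓ¹ torus, `h342_1`, `h342_2`
DISCHARGED**: `B9Thm37GlueTorusInv.thm37_entry1_l1_pos` with its Corollary-3.6-type inputs supplied by `h342_1_rw`,
`h342_2_rw` — no operator-theoretic hypothesis left (REMAINING: compatibility, `hRm`, ranges, `hsmall`, q ≥ q_min > 0,
r ≤ e^{−δ₀}, `hB1`, `hB2`, `hχ01`, `hχ`).  MODEL regime (massive, one scale); print's Corollary 3.6 NOT asserted.
[cite: Balaban1985BackgroundPropagators, Thm 3.7 (3.87)–(3.90) pp.408–410 + (3.42) p.397 + Cor 3.6 p.409 + p.394 + p.395] -/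
theorem thm37_entry1_l1_rw {M₀ : ℕ} (hM : 1 ≤ M₀) (hdiv : ∀ i, M₀ ∣ N i)
    (h2N : ∀ i, 2 * M₀ ≤ N i) (η L M R : ℝ) (H : Prop) (hη : 0 ≤ η) (c₀ : ℝ)
    (Rm : UT N × Fin d → Cp → Cp → ℝ) (q : UT N × Cp → ℝ) (δ₀ α ρ B₀ : ℝ)
    (hRm : ∀ b i j, ∑ k, Rm b k i * Rm b k j = if i = j then 1 else 0)
    (hB₀ : 0 ≤ B₀) (hδ₀ : 0 < δ₀) (hα : 0 < α) (hα1 : α ≤ 1) (hρ : 1 ≤ ρ)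
    (hsmall : (7 : ℝ) ^ d * (B₀ * Real.exp (δ₀ * ρ) *
        ((d + d * Fintype.card Cp : ℝ) * (|c₀| * (4 * d / (M₀ : ℝ)) * ((2 * ⌊ρ⌋₊ + 1 : ℝ) ^ d * η)) +
          c₀ ^ 2 * (52 * d / (M₀ : ℝ) ^ 2) * η ^ 2)) * B6.c1 d δ₀ α < 1)
    {qmin : ℝ} (hqmin : 0 < qmin) (hq : ∀ p, qmin ≤ q p) (hre : rwRate d c₀ qmin ≤ Real.exp (-δ₀))
    (hB1 : Real.sqrt (Fintype.card Cp) / qmin ≤ B₀ * η ^ 2)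
    (hB2 : |c₀| * Real.sqrt (Fintype.card Cp) * (1 + Real.exp δ₀) / qmin ≤ B₀ * η)
    {χ : Ctr N M₀ → UT N → ℝ} (hχ01 : ∀ i x, χ i x = 0 ∨ χ i x = 1)
    (hχ : ∀ i x, dist x (ctrU N M₀ i) < M₀ + 1 → χ i x = 1) :
    HasMajorant (g := toB6 (torusGeom N η L M) R H) (cblk (chart0 N η L M))
      (Ring.inverse (covDT bsrc btgt (fun _ : UT N × Fin d => c₀) Rm ∘ₗ
          covD bsrc btgt (fun _ : UT N × Fin d => c₀) Rm + mulOp q))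
      (fun (a b : UT N) => (5 : ℝ) ^ d * B₀ * B6.c1 d δ₀ α *
        (1 - (7 : ℝ) ^ d * (B₀ * Real.exp (δ₀ * ρ) *
          ((d + d * Fintype.card Cp : ℝ) * (|c₀| * (4 * d / (M₀ : ℝ)) * ((2 * ⌊ρ⌋₊ + 1 : ℝ) ^ d * η)) +
            c₀ ^ 2 * (52 * d / (M₀ : ℝ) ^ 2) * η ^ 2)) * B6.c1 d δ₀ α)⁻¹ * η ^ 2 *
        Real.exp (-((1 - α) * δ₀ * tdist1 N a b)))  :=
  thm37_entry1_l1_pos hM hdiv h2N η L M R H hη c₀ Rm q δ₀ α ρ B₀ hRm hB₀ hδ₀ hα hα1 hρ hsmall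
    (fun p => lt_of_lt_of_le hqmin (hq p)) hχ01 hχ
    (h342_1_rw η L M R H c₀ Rm hRm q hqmin hq hre hB1 hχ01)
    (h342_2_rw η L M R H c₀ Rm hRm q hqmin hq hδ₀.le hre hB2 hχ01)

/-- **Entry 2 of (3.42) for G′ = (Δ_U + M_q)^{−1} (|∇_U G′|, weight η) on the one-scale ℓ¹ torus, `h342_1`, `h342_2`
DISCHARGED**: `B9Thm37GlueTorusInv.thm37_entry2_l1_pos` with `h342_1_rw`, `h342_2_rw` (REMAINING: compatibility,
`hRm`, ranges, `hsmall`, q ≥ q_min > 0, r ≤ e^{−δ₀}, `hB1`, `hB2`, `hχ01`, `hχ`).  MODEL regime; print's Corollary 3.6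
NOT asserted. [cite: Balaban1985BackgroundPropagators, Thm 3.7 (3.87)–(3.90) pp.408–410 + (3.42) p.397 + Cor 3.6 p.409 + (3.3) pp.390–391] -/
theorem thm37_entry2_l1_rw {M₀ : ℕ} (hM : 1 ≤ M₀) (hdiv : ∀ i, M₀ ∣ N i)
    (h2N : ∀ i, 2 * M₀ ≤ N i) (η L M R : ℝ) (H : Prop) (hη : 0 ≤ η) (c₀ : ℝ)
    (Rm : UT N × Fin d → Cp → Cp → ℝ) (q : UT N × Cp → ℝ) (δ₀ α ρ B₀ : ℝ)
    (hRm : ∀ b i j, ∑ k, Rm b k i * Rm b k j = if i = j then 1 else 0)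
    (hB₀ : 0 ≤ B₀) (hδ₀ : 0 < δ₀) (hα : 0 < α) (hα1 : α ≤ 1) (hρ : 1 ≤ ρ)
    (hsmall : (7 : ℝ) ^ d * (B₀ * Real.exp (δ₀ * ρ) *
        ((d + d * Fintype.card Cp : ℝ) * (|c₀| * (4 * d / (M₀ : ℝ)) * ((2 * ⌊ρ⌋₊ + 1 : ℝ) ^ d * η)) +
          c₀ ^ 2 * (52 * d / (M₀ : ℝ) ^ 2) * η ^ 2)) * B6.c1 d δ₀ α < 1)
    {qmin : ℝ} (hqmin : 0 < qmin) (hq : ∀ p, qmin ≤ q p) (hre : rwRate d c₀ qmin ≤ Real.exp (-δ₀))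
    (hB1 : Real.sqrt (Fintype.card Cp) / qmin ≤ B₀ * η ^ 2)
    (hB2 : |c₀| * Real.sqrt (Fintype.card Cp) * (1 + Real.exp δ₀) / qmin ≤ B₀ * η)
    {χ : Ctr N M₀ → UT N → ℝ} (hχ01 : ∀ i x, χ i x = 0 ∨ χ i x = 1)
    (hχ : ∀ i x, dist x (ctrU N M₀ i) < M₀ + 1 → χ i x = 1) :
    HasMajorantHom (g := toB6 (torusGeom N η L M) R H) (cblk (chart0 N η L M)) (cblkY (chart0 N η L M))
      (covD bsrc btgt (fun _ : UT N × Fin d => c₀) Rm ∘ₗ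
        Ring.inverse (covDT bsrc btgt (fun _ : UT N × Fin d => c₀) Rm ∘ₗ
          covD bsrc btgt (fun _ : UT N × Fin d => c₀) Rm + mulOp q))
      (fun (a b : UT N) => B₀ * ((7 : ℝ) ^ d + (7 : ℝ) ^ d * Real.exp (δ₀ * ρ) *
          (|c₀| * (4 * d / (M₀ : ℝ)) * ((2 * ⌊ρ⌋₊ + 1 : ℝ) ^ d * η))) * B6.c1 d δ₀ α *
        (1 - (7 : ℝ) ^ d * (B₀ * Real.exp (δ₀ * ρ) *
          ((d + d * Fintype.card Cp : ℝ) * (|c₀| * (4 * d / (M₀ : ℝ)) * ((2 * ⌊ρ⌋₊ + 1 : ℝ) ^ d * η)) +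
            c₀ ^ 2 * (52 * d / (M₀ : ℝ) ^ 2) * η ^ 2)) * B6.c1 d δ₀ α)⁻¹ * η *
        Real.exp (-((1 - α) * δ₀ * tdist1 N a b)))  :=
  thm37_entry2_l1_pos hM hdiv h2N η L M R H hη c₀ Rm q δ₀ α ρ B₀ hRm hB₀ hδ₀ hα hα1 hρ hsmall
    (fun p => lt_of_lt_of_le hqmin (hq p)) hχ01 hχ
    (h342_1_rw η L M R H c₀ Rm hRm q hqmin hq hre hB1 hχ01)
    (h342_2_rw η L M R H c₀ Rm hRm q hqmin hq hδ₀.le hre hB2 hχ01)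

/-- **Entry 4 of (3.42) for G′ = (Δ_U + M_q)^{−1} (|Δ_U G′|, weight 1) on the one-scale ℓ¹ torus, `h342_1`, `h342_2`,
`h342_4` DISCHARGED**: `B9Thm37GlueTorusInv.thm37_entry4_l1_pos` with `h342_1_rw`, `h342_2_rw`, `h342_4_rw`
(REMAINING: compatibility, `hRm`, ranges, `hsmall`, q ≥ q_min > 0, r ≤ e^{−δ₀}, `hB1`, `hB2`, `hB4`, `hχ01`, `hχ`).
MODEL regime; print's Corollary 3.6 NOT asserted. [cite: Balaban1985BackgroundPropagators, Thm 3.7 (3.87)–(3.90) pp.408–410 + (3.42) p.397 + Cor 3.6 p.409 + (3.23) p.394] -/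
theorem thm37_entry4_l1_rw {M₀ : ℕ} (hM : 1 ≤ M₀) (hdiv : ∀ i, M₀ ∣ N i)
    (h2N : ∀ i, 2 * M₀ ≤ N i) (η L M R : ℝ) (H : Prop) (hη : 0 ≤ η) (c₀ : ℝ)
    (Rm : UT N × Fin d → Cp → Cp → ℝ) (q : UT N × Cp → ℝ) (δ₀ α ρ B₀ : ℝ)
    (hRm : ∀ b i j, ∑ k, Rm b k i * Rm b k j = if i = j then 1 else 0)
    (hB₀ : 0 ≤ B₀) (hδ₀ : 0 < δ₀) (hα : 0 < α) (hα1 : α ≤ 1) (hρ : 1 ≤ ρ)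
    (hsmall : (7 : ℝ) ^ d * (B₀ * Real.exp (δ₀ * ρ) *
        ((d + d * Fintype.card Cp : ℝ) * (|c₀| * (4 * d / (M₀ : ℝ)) * ((2 * ⌊ρ⌋₊ + 1 : ℝ) ^ d * η)) +
          c₀ ^ 2 * (52 * d / (M₀ : ℝ) ^ 2) * η ^ 2)) * B6.c1 d δ₀ α < 1)
    {qmin : ℝ} (hqmin : 0 < qmin) (hq : ∀ p, qmin ≤ q p) (hre : rwRate d c₀ qmin ≤ Real.exp (-δ₀))
    (hB1 : Real.sqrt (Fintype.card Cp) / qmin ≤ B₀ * η ^ 2)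
    (hB2 : |c₀| * Real.sqrt (Fintype.card Cp) * (1 + Real.exp δ₀) / qmin ≤ B₀ * η)
    (hB4 : 2 * d * c₀ ^ 2 * Real.sqrt (Fintype.card Cp) * (1 + Real.exp δ₀) / qmin ≤ B₀)
    {χ : Ctr N M₀ → UT N → ℝ} (hχ01 : ∀ i x, χ i x = 0 ∨ χ i x = 1)
    (hχ : ∀ i x, dist x (ctrU N M₀ i) < M₀ + 1 → χ i x = 1) :
    HasMajorantHom (g := toB6 (torusGeom N η L M) R H) (cblk (chart0 N η L M)) (cblk (chart0 N η L M))
      ((covDT bsrc btgt (fun _ : UT N × Fin d => c₀) Rm ∘ₗ covD bsrc btgt (fun _ : UT N × Fin d => c₀) Rm) ∘ₗ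
        Ring.inverse (covDT bsrc btgt (fun _ : UT N × Fin d => c₀) Rm ∘ₗ
          covD bsrc btgt (fun _ : UT N × Fin d => c₀) Rm + mulOp q))
      (fun (a b : UT N) => B₀ * ((5 : ℝ) ^ d + (7 : ℝ) ^ d * Real.exp (δ₀ * ρ) *
          ((d + d * Fintype.card Cp : ℝ) * (|c₀| * (4 * d / (M₀ : ℝ)) * ((2 * ⌊ρ⌋₊ + 1 : ℝ) ^ d * η)) +
            c₀ ^ 2 * (52 * d / (M₀ : ℝ) ^ 2) * η ^ 2)) *
        B6.c1 d δ₀ α *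
        (1 - (7 : ℝ) ^ d * (B₀ * Real.exp (δ₀ * ρ) *
          ((d + d * Fintype.card Cp : ℝ) * (|c₀| * (4 * d / (M₀ : ℝ)) * ((2 * ⌊ρ⌋₊ + 1 : ℝ) ^ d * η)) +
            c₀ ^ 2 * (52 * d / (M₀ : ℝ) ^ 2) * η ^ 2)) * B6.c1 d δ₀ α)⁻¹ *
        Real.exp (-((1 - α) * δ₀ * tdist1 N a b)))  :=
  thm37_entry4_l1_pos hM hdiv h2N η L M R H hη c₀ Rm q δ₀ α ρ B₀ hRm hB₀ hδ₀ hα hα1 hρ hsmall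
    (fun p => lt_of_lt_of_le hqmin (hq p)) hχ01 hχ
    (h342_1_rw η L M R H c₀ Rm hRm q hqmin hq hre hB1 hχ01)
    (h342_2_rw η L M R H c₀ Rm hRm q hqmin hq hδ₀.le hre hB2 hχ01)
    (h342_4_rw η L M R H c₀ Rm hRm q hqmin hq hδ₀.le hre hB4 hχ01)

/-- **Entry 3 of (3.42) for G′ = (Δ_U + M_q)^{−1} (|G′∇\*_U|, weight η) on the one-scale ℓ¹ torus, `h342_1`, `h342_3`
DISCHARGED**: `B9Thm37GlueTorusInv.thm37_entry3_l1_pos` with `h342_1_rw`, `h342_3_rw` (REMAINING: compatibility,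
`hRm`, ranges incl. 0 < η and 2α ≤ 1, `hsmall`, q ≥ q_min > 0, r ≤ e^{−δ₀}, `hB1`, `hB3`, `hχ01`, `hχ`).  MODEL regime;
print's Corollary 3.6 NOT asserted. [cite: Balaban1985BackgroundPropagators, Thm 3.7 (3.87)–(3.90) pp.408–410 + (3.42) p.397 + Cor 3.6 p.409 + (3.8) p.392] -/
theorem thm37_entry3_l1_rw {M₀ : ℕ} (hM : 1 ≤ M₀) (hdiv : ∀ i, M₀ ∣ N i)
    (h2N : ∀ i, 2 * M₀ ≤ N i) (η L M R : ℝ) (H : Prop) (hη : 0 < η) (c₀ : ℝ)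
    (Rm : UT N × Fin d → Cp → Cp → ℝ) (q : UT N × Cp → ℝ) (δ₀ α ρ B₀ : ℝ)
    (hRm : ∀ b i j, ∑ k, Rm b k i * Rm b k j = if i = j then 1 else 0)
    (hB₀ : 0 ≤ B₀) (hδ₀ : 0 < δ₀) (hα : 0 < α) (hα2 : 2 * α ≤ 1) (hρ : 1 ≤ ρ)
    (hsmall : (7 : ℝ) ^ d * (B₀ * Real.exp (δ₀ * ρ) *
        ((1 + Fintype.card Cp : ℝ) * (|c₀| * (4 * d / (M₀ : ℝ)) * ((2 * ⌊ρ⌋₊ + 1 : ℝ) ^ d * η)) +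
          c₀ ^ 2 * (52 * d / (M₀ : ℝ) ^ 2) * η ^ 2)) * B6.c1 d δ₀ α < 1)
    {qmin : ℝ} (hqmin : 0 < qmin) (hq : ∀ p, qmin ≤ q p) (hre : rwRate d c₀ qmin ≤ Real.exp (-δ₀))
    (hB1 : Real.sqrt (Fintype.card Cp) / qmin ≤ B₀ * η ^ 2)
    (hB3 : d * |c₀| * Real.sqrt (Fintype.card Cp) * (1 + Real.exp δ₀) / qmin ≤ B₀ * η)
    {χ : Ctr N M₀ → UT N → ℝ} (hχ01 : ∀ i x, χ i x = 0 ∨ χ i x = 1)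
    (hχ : ∀ i x, dist x (ctrU N M₀ i) < M₀ + 1 → χ i x = 1) :
    HasMajorantHom (g := toB6 (torusGeom N η L M) R H) (cblkY (chart0 N η L M)) (cblk (chart0 N η L M))
      (Ring.inverse (covDT bsrc btgt (fun _ : UT N × Fin d => c₀) Rm ∘ₗ
          covD bsrc btgt (fun _ : UT N × Fin d => c₀) Rm + mulOp q) ∘ₗ
        covDT bsrc btgt (fun _ : UT N × Fin d => c₀) Rm)
      (fun (a b : UT N) => B₀ * ((5 : ℝ) ^ d + (7 : ℝ) ^ d * Real.exp (δ₀ * ρ) *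
          (d * (|c₀| * (4 * d / (M₀ : ℝ)) * ((2 * ⌊ρ⌋₊ + 1 : ℝ) ^ d * η)))) * B6.c1 d δ₀ α *
        (1 - (7 : ℝ) ^ d * (B₀ * Real.exp (δ₀ * ρ) *
          ((1 + Fintype.card Cp : ℝ) * (|c₀| * (4 * d / (M₀ : ℝ)) * ((2 * ⌊ρ⌋₊ + 1 : ℝ) ^ d * η)) +
            c₀ ^ 2 * (52 * d / (M₀ : ℝ) ^ 2) * η ^ 2)) * B6.c1 d δ₀ α)⁻¹ * η *
        Real.exp (-((1 - 2 * α) * δ₀ * tdist1 N a b)))  :=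
  thm37_entry3_l1_pos hM hdiv h2N η L M R H hη c₀ Rm q δ₀ α ρ B₀ hRm hB₀ hδ₀ hα hα2 hρ hsmall
    (fun p => lt_of_lt_of_le hqmin (hq p)) hχ01 hχ
    (h342_1_rw η L M R H c₀ Rm hRm q hqmin hq hre hB1 hχ01)
    (h342_3_rw η L M R H c₀ Rm hRm q hqmin hq hδ₀.le hre hB3 hχ01)

end Capstone

/-- **Scaling of the rate (non-vacuity).**  In lattice units c₀ = η^{−1} with a mass of the order of the cutoff,
q_min = a₀η^{−2}, the rate r = 2dc₀²/(2dc₀² + q_min) = 2d/(2d + a₀) does not depend on η — so `hre` and the four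
constant inequalities of the capstones hold with η-free δ₀, B₀ (module header). [folklore] -/
theorem rwRate_scale (d : ℕ) {η : ℝ} (hη : η ≠ 0) (a₀ : ℝ) :
    rwRate d η⁻¹ (a₀ * η⁻¹ ^ 2) = 2 * d / (2 * d + a₀) := by
  unfold rwRate
  have h2 : (η⁻¹) ^ 2 ≠ 0 := pow_ne_zero 2 (inv_ne_zero hη)
  rw [show 2 * (d : ℝ) * η⁻¹ ^ 2 + a₀ * η⁻¹ ^ 2 = (2 * d + a₀) * η⁻¹ ^ 2 by ring,
    show 2 * (d : ℝ) * η⁻¹ ^ 2 = (2 * d) * η⁻¹ ^ 2 by ring]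
  rw [mul_div_mul_right _ _ h2]

end

end Literature.MathematicalPhysics.QuantumFieldTheory.Balaban1983to89.B9Thm37GlueTorusRW
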